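import Literature.MathematicalPhysics.KineticTheory.InfiniteChainLightCone
import Literature.MathematicalPhysics.KineticTheory.EvenPolynomialPotentials
import Mathlib.Analysis.Calculus.MeanValue
import Mathlib.Analysis.SpecialFunctions.Integrals.Basic
import Mathlib.MeasureTheory.Integral.IntervalIntegral.FundThmCalculus
import Mathlib.Analysis.SpecificLimits.Basic
import Mathlib.Analysis.Complex.ExponentialBounds
import Mathlib.Analysis.SpecialFunctions.Pow.Asymptotics
import Mathlib.MeasureTheory.OuterMeasure.BorelCantelli
import Mathlib.Analysis.PSeries
import HarnessLib

/-!
# Proof of Buttà–Marchioro 2016, Theorem 2.2 (the almost-linear light cone of the chain)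

Topic `Literature/MathematicalPhysics/KineticTheory`; companion of `InfiniteChainLightCone.lean`,
whose named fact `OscillatorChain.ButtaMarchioro2016_thm22_chain` (P. Buttà, C. Marchioro,
*Dynamics of infinite classical anharmonic crystals*, J. Stat. Phys. 164 (2016) 680–692,
arXiv:1602.01294, §2 Thm 2.2, case `d = ν = 1`) is DISCHARGED here:
`OscillatorChain.ButtaMarchioro2016_thm22_chain_holds`. Everything in this file is proved; no new
definitions, no new facts.

## The argument (BM §4, pp. 9–10) and how it is formalised

1. *Borel–Cantelli* (`ae_eventually_growth_le`). For `δ > 1`, `ω`-a.s. `Q(Φ_k x) ≤ log^δ k` for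
   all large integers `k`: `ω(Q∘Φ_k > N) = ω(Q > N)` by invariance of `ω` under `Φ_k`, the
   exponential tail of `Q` under (2.3) (the union bound `measure_bmGrowthSet_gt_le` of
   `InfiniteChainSuperstableDynamics`, i.e. BM (2.6)), and `Σ_k e^{-λ₀ log^δ k} < ∞`.
2. *Growth control on `[0,t]`* (`growth_control`, BM (4.8)). From the group law and the growth
   bound (2.7) on time intervals of length `≤ 1`: `sup_{s ≤ t} Q(Φ_s x) ≤ M + C (log t)^{2δ/(2-γ)}`
   for all large `t`.
3. *Sensitivity of `Φ_t(x)_j` to `x_i`* (`perturbation_bound`, BM (4.3)–(4.9)). BM manipulate the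
   Jacobian `Δ_{j,i}(t,x) = D_{x_i}Φ_t(x)_j` formally (its existence for the infinite system is not
   proved in the paper). We prove instead, directly for the flow, that all sufficiently small
   modifications `z` of `x_i` satisfy `‖Φ_t(x^z)_j - Φ_t(x)_j‖ ≤ 2‖z - x_i‖ 2^{-|j-i|}` in the
   regime `2e·3a·(1 + log(e + 2|j-i|))·t ≤ |j-i|`, `a = C log(e+|i|) sup_{s≤t} Q(Φ_s x)`. The tool
   is an abstract *lattice iteration* (`BMLightCone.lattice_iteration`: the quantitative
   Lanford–Lebowitz–Lieb / Dobrushin–Fritz scheme, first order in time, with site-dependent rates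
   `a g(|k-i|+m)` and the a priori bound killing the remainder), applied TWICE: a crude pass with
   rates from the `Q` of both trajectories (polynomial in `t`, by (2.7)) shows that the perturbed
   trajectory stays within distance `1` of the unperturbed one at every site up to time `t`; then
   the sharp pass uses rates controlled by the unperturbed trajectory only. The force is
   Lipschitz with constant `C (S_k(σ) + S_k(σ'))`, `S_k = p_k²/2 + U(q_k) + 1 + V(q_{k+1}-q_k) +
   V(q_k-q_{k-1}) ≤ 5 log(e+|k|) Q` (`lc_force_sub_le`, `lc_site_le`), from elementary facts on
   even polynomials (`IsEvenPolyOfDegree.lipschitz_deriv`, `.pow_le`, `.perturb_le`).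
4. *The bracket* (`bracket_le`). The tree's bracket is built from one-variable `deriv`s; a
   derivative is bounded by any local Lipschitz constant (and is the junk value `0` where the
   function is not differentiable), so `|{f_i, Φ_t g_j}(x)| ≤ 2‖Df‖_∞‖Dg‖_∞ · 2·2^{-|j-i|}`.
5. *Conclusion* (`lightCone_at`, then the theorem). For `|i-j| > t log^α t` the regime holds for
   large `t` as soon as `2δ/(2-γ) + 1 < α`; such `γ ∈ (η,2)`, `δ > 1` exist exactly because
   `α > (4-η)/(2-η)` (`exists_gamma_delta`), and `e^{bt} 2^{-t log^α t} → 0`.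

## Deviations from the printed proof (all conservative)

* We use the bound `|U''| ≤ C(1 + U)` (exponent `1`) instead of BM's `|U''| ≤ C W^η`, and the
  first-order iteration (`n!`) instead of BM's second-order one (`(2n)!`); the printed hypothesis
  `α > (4-η)/(2-η)` is exactly what this cruder bookkeeping needs (BM's own choice (4.1) of `δ` is
  not optimised either).
* Difference quotients of the true flow replace the formal Jacobian series; no differentiability
  of `x ↦ Φ_t(x)` is claimed or needed.

## NOT here

Nothing about `d ≥ 2`, `ν ≥ 2`, or about the existence of the flow (Thm 2.1 stays the named fact
`ButtaMarchioro2016_thm21_chain`; Thm 2.2 takes the flow as data, as transcribed in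
`InfiniteChainLightCone.lean`).
-/

noncomputable section


open MeasureTheory Set Filter Finset
open scoped Topology ENNReal BigOperators

namespace Literature.MathematicalPhysics.KineticTheory.HeatConduction

namespace BMLightCone

variable {g : ℕ → ℝ} {t ε a B : ℝ} {i : ℤ} {u : ℤ → ℝ → ℝ}

/-- Monotonicity of the iteration term `(3 a g(ρ) s)^m / m!` in `ρ` and `s`. [folklore] -/
theorem iterTerm_mono (hg1 : ∀ n, 1 ≤ g n) (hgm : Monotone g) (ha : 0 ≤ a)
    {ρ ρ' : ℕ} (hρ : ρ ≤ ρ') {s s' : ℝ} (hs : 0 ≤ s) (hss' : s ≤ s') (m : ℕ) :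
    (3 * a * g ρ * s) ^ m / (m.factorial : ℝ) ≤ (3 * a * g ρ' * s') ^ m / (m.factorial : ℝ) := by
  have hg0 : 0 ≤ g ρ := zero_le_one.trans (hg1 ρ)
  have hg0' : 0 ≤ g ρ' := zero_le_one.trans (hg1 ρ')
  have hgg : g ρ ≤ g ρ' := hgm hρ
  apply div_le_div_of_nonneg_right _ (by positivity)
  apply pow_le_pow_left₀ (by positivity)
  gcongr

/-- Nonnegativity of the iteration term. [folklore] -/
theorem iterTerm_nonneg (hg1 : ∀ n, 1 ≤ g n) (ha : 0 ≤ a) (ρ : ℕ) {s : ℝ} (hs : 0 ≤ s)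
    (m : ℕ) : 0 ≤ (3 * a * g ρ * s) ^ m / (m.factorial : ℝ) := by
  have hg0 : 0 ≤ g ρ := zero_le_one.trans (hg1 ρ)
  positivity

/-- `∫₀^τ (c s)^m / m! ds = c^m τ^{m+1} / ((m+1) m!)`. [folklore] -/
theorem integral_iterTerm (c : ℝ) (m : ℕ) (τ : ℝ) :
    ∫ s in (0:ℝ)..τ, (c * s) ^ m / (m.factorial : ℝ) =
      c ^ m * τ ^ (m + 1) / ((m + 1 : ℝ) * m.factorial) := by
  have h1 : (fun s : ℝ => (c * s) ^ m / (m.factorial : ℝ)) =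
      fun s => c ^ m / (m.factorial : ℝ) * s ^ m := by
    funext s; rw [mul_pow]; ring
  rw [h1, intervalIntegral.integral_const_mul, integral_pow, zero_pow (Nat.succ_ne_zero m), sub_zero]
  have hm : ((m : ℝ) + 1) ≠ 0 := by positivity
  have hf : (m.factorial : ℝ) ≠ 0 := by positivity
  field_simp

/-- The key algebraic step of the iteration: `a g(r) · 3 · (3 a g ρ)^m τ^{m+1}/((m+1) m!) ≤
(3 a g ρ τ)^{m+1}/(m+1)!` when `g r ≤ g ρ`. [folklore] -/
theorem iter_keyStep (hg1 : ∀ n, 1 ≤ g n) (ha : 0 ≤ a) {r ρ : ℕ} (hgr : g r ≤ g ρ)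
    {τ : ℝ} (hτ : 0 ≤ τ) (m : ℕ) :
    a * g r * (3 * ((3 * a * g ρ) ^ m * τ ^ (m + 1) / ((m + 1 : ℝ) * m.factorial))) ≤
      (3 * a * g ρ * τ) ^ (m + 1) / ((m + 1).factorial : ℝ) := by
  have hg0 : 0 ≤ g ρ := zero_le_one.trans (hg1 ρ)
  have hgr0 : 0 ≤ g r := zero_le_one.trans (hg1 r)
  rw [Nat.factorial_succ]
  push_cast
  calc a * g r * (3 * ((3 * a * g ρ) ^ m * τ ^ (m + 1) / ((m + 1 : ℝ) * m.factorial)))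
      = (3 * a * g r) * ((3 * a * g ρ) ^ m * τ ^ (m + 1)) / ((m + 1 : ℝ) * m.factorial) := by ring
    _ ≤ (3 * a * g ρ) * ((3 * a * g ρ) ^ m * τ ^ (m + 1)) / ((m + 1 : ℝ) * m.factorial) := by
        gcongr
    _ = (3 * a * g ρ * τ) ^ (m + 1) / ((m + 1 : ℝ) * m.factorial) := by ring

/-- **Abstract lattice iteration** (the quantitative Lanford–Lebowitz–Lieb / Dobrushin–Fritz
scheme behind BM §4 (4.3)–(4.7), first-order version). Nonnegative continuous `u_k` on `[0,t]`
with `u_k(0) ≤ ε 1_{k=i}`, a priori bound `u_k ≤ B g(|k-i|)` and the integral inequalities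
`u_k(τ) ≤ u_k(0) + a g(|k-i|) ∫₀^τ (u_{k-1} + u_k + u_{k+1})` satisfy, for every `n`,
`u_k(τ) ≤ ε Σ_{m=|k-i|}^{n-1} (3a g(|k-i|+m) τ)^m/m! + (3a g(|k-i|+n) τ)^n/n! · B g(|k-i|+n)`.
[cite: ButtaMarchioro2016, §4 eqs. (4.3)–(4.7)] -/
theorem lattice_iteration (hg1 : ∀ n, 1 ≤ g n) (hgm : Monotone g)
    (hε : 0 ≤ ε) (ha : 0 ≤ a) (hB : 0 ≤ B)
    (hu_cont : ∀ k, ContinuousOn (u k) (Icc 0 t))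
    (hu_bd : ∀ k, ∀ s ∈ Icc 0 t, u k s ≤ B * g (k - i).natAbs)
    (hu_i : u i 0 ≤ ε) (hu_0 : ∀ k, k ≠ i → u k 0 ≤ 0)
    (hu_int : ∀ k, ∀ τ ∈ Icc 0 t, u k τ ≤ u k 0 +
      a * g (k - i).natAbs * ∫ s in (0:ℝ)..τ, (u (k - 1) s + u k s + u (k + 1) s))
    (n : ℕ) (k : ℤ) {τ : ℝ} (hτ : τ ∈ Icc 0 t) :
    u k τ ≤ ε * ∑ m ∈ Finset.Ico (k - i).natAbs n,
        (3 * a * g ((k - i).natAbs + m) * τ) ^ m / (m.factorial : ℝ) +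
      (3 * a * g ((k - i).natAbs + n) * τ) ^ n / (n.factorial : ℝ) *
        (B * g ((k - i).natAbs + n)) := by
  induction n generalizing k τ with
  | zero =>
    rw [Finset.Ico_eq_empty_of_le (Nat.zero_le _), Finset.sum_empty, mul_zero, zero_add, pow_zero,
      Nat.factorial_zero, Nat.cast_one, div_one, one_mul, Nat.add_zero]
    exact hu_bd k τ hτ
  | succ n ih =>
    obtain ⟨hτ0, hτt⟩ := hτ
    have hg0 : ∀ ρ, 0 ≤ g ρ := fun ρ => zero_le_one.trans (hg1 ρ)
    set r : ℕ := (k - i).natAbs with hr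
    -- the common bound for the three neighbours on `[0, τ]`
    set P : ℝ → ℝ := fun s => ε * ∑ m ∈ Finset.Ico (r - 1) n,
        (3 * a * g (r + (m + 1)) * s) ^ m / (m.factorial : ℝ) +
      (3 * a * g (r + (n + 1)) * s) ^ n / (n.factorial : ℝ) * (B * g (r + (n + 1))) with hP
    have hPcont : Continuous P := by
      simp only [hP]
      fun_prop
    have hbound : ∀ l : ℤ, (l - i).natAbs ≤ r + 1 → r - 1 ≤ (l - i).natAbs →
        ∀ s ∈ Icc 0 τ, u l s ≤ P s := by
      intro l hl1 hl2 s hs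
      have hst : s ∈ Icc 0 t := ⟨hs.1, hs.2.trans hτt⟩
      refine (ih l hst).trans ?_
      have h1 : ∑ m ∈ Finset.Ico (l - i).natAbs n,
            (3 * a * g ((l - i).natAbs + m) * s) ^ m / (m.factorial : ℝ) ≤
          ∑ m ∈ Finset.Ico (l - i).natAbs n,
            (3 * a * g (r + (m + 1)) * s) ^ m / (m.factorial : ℝ) :=
        Finset.sum_le_sum fun m _ => iterTerm_mono hg1 hgm ha (by omega) hs.1 le_rfl m
      have h2 : ∑ m ∈ Finset.Ico (l - i).natAbs n,
            (3 * a * g (r + (m + 1)) * s) ^ m / (m.factorial : ℝ) ≤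
          ∑ m ∈ Finset.Ico (r - 1) n, (3 * a * g (r + (m + 1)) * s) ^ m / (m.factorial : ℝ) :=
        Finset.sum_le_sum_of_subset_of_nonneg (Finset.Ico_subset_Ico hl2 le_rfl)
          fun m _ _ => iterTerm_nonneg hg1 ha _ hs.1 m
      have h3 : (3 * a * g ((l - i).natAbs + n) * s) ^ n / (n.factorial : ℝ) *
            (B * g ((l - i).natAbs + n)) ≤
          (3 * a * g (r + (n + 1)) * s) ^ n / (n.factorial : ℝ) * (B * g (r + (n + 1))) := by
        have hmn : (l - i).natAbs + n ≤ r + (n + 1) := by omega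
        have := iterTerm_mono hg1 hgm ha hmn hs.1 le_rfl n
        have hgg : g ((l - i).natAbs + n) ≤ g (r + (n + 1)) := hgm hmn
        have hnn := iterTerm_nonneg hg1 ha (r + (n + 1)) hs.1 n
        have := hg0 ((l - i).natAbs + n)
        gcongr
      have := add_le_add (mul_le_mul_of_nonneg_left (h1.trans h2) hε) h3
      simpa only [hP] using this
    -- integrability
    have hcu : ∀ l, ContinuousOn (u l) (Icc 0 τ) := fun l =>
      (hu_cont l).mono (Icc_subset_Icc le_rfl hτt)
    have hint3 : IntervalIntegrable (fun s => u (k - 1) s + u k s + u (k + 1) s) volume 0 τ := by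
      apply ContinuousOn.intervalIntegrable
      rw [uIcc_of_le hτ0]
      exact ((hcu _).add (hcu _)).add (hcu _)
    have hmono : ∫ s in (0:ℝ)..τ, (u (k - 1) s + u k s + u (k + 1) s) ≤
        ∫ s in (0:ℝ)..τ, 3 * P s := by
      apply intervalIntegral.integral_mono_on hτ0 hint3
        ((hPcont.const_mul 3).intervalIntegrable _ _)
      intro s hs
      have h1 := hbound (k - 1) (by omega) (by omega) s hs
      have h2 := hbound k (by omega) (by omega) s hs
      have h3 := hbound (k + 1) (by omega) (by omega) s hs
      linarith
    -- the integral of the bound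
    have hPint : ∫ s in (0:ℝ)..τ, 3 * P s = 3 * (ε * ∑ m ∈ Finset.Ico (r - 1) n,
        (3 * a * g (r + (m + 1))) ^ m * τ ^ (m + 1) / ((m + 1 : ℝ) * m.factorial) +
        (3 * a * g (r + (n + 1))) ^ n * τ ^ (n + 1) / ((n + 1 : ℝ) * n.factorial) *
          (B * g (r + (n + 1)))) := by
      rw [intervalIntegral.integral_const_mul]
      congr 1
      have hti : ∀ (ρ m : ℕ), IntervalIntegrable
          (fun s : ℝ => (3 * a * g ρ * s) ^ m / (m.factorial : ℝ)) volume 0 τ := fun ρ m =>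
        (by fun_prop : Continuous fun s : ℝ => (3 * a * g ρ * s) ^ m / (m.factorial : ℝ)).intervalIntegrable _ _
      have hsi : IntervalIntegrable (fun s : ℝ => ε * ∑ m ∈ Finset.Ico (r - 1) n,
          (3 * a * g (r + (m + 1)) * s) ^ m / (m.factorial : ℝ)) volume 0 τ :=
        (by fun_prop : Continuous fun s : ℝ => ε * ∑ m ∈ Finset.Ico (r - 1) n,
          (3 * a * g (r + (m + 1)) * s) ^ m / (m.factorial : ℝ)).intervalIntegrable _ _
      have hri : IntervalIntegrable (fun s : ℝ => (3 * a * g (r + (n + 1)) * s) ^ n /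
          (n.factorial : ℝ) * (B * g (r + (n + 1)))) volume 0 τ :=
        (hti _ _).mul_const _
      simp only [hP]
      rw [intervalIntegral.integral_add hsi hri, intervalIntegral.integral_const_mul,
        intervalIntegral.integral_finsetSum (fun m _ => hti _ _),
        intervalIntegral.integral_mul_const, integral_iterTerm]
      congr 2
      exact Finset.sum_congr rfl fun m _ => integral_iterTerm _ _ _
    -- assemble
    have hstep := hu_int k τ ⟨hτ0, hτt⟩
    have hagr : 0 ≤ a * g r := mul_nonneg ha (hg0 r)
    have hmain : u k τ ≤ u k 0 +
        (ε * ∑ m ∈ Finset.Ico (r - 1) n,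
            (3 * a * g (r + (m + 1)) * τ) ^ (m + 1) / ((m + 1).factorial : ℝ) +
          (3 * a * g (r + (n + 1)) * τ) ^ (n + 1) / ((n + 1).factorial : ℝ) *
            (B * g (r + (n + 1)))) := by
      refine hstep.trans (add_le_add le_rfl ?_)
      -- abbreviations for the pieces
      set X : ℕ → ℝ := fun m => (3 * a * g (r + (m + 1))) ^ m * τ ^ (m + 1) /
        ((m + 1 : ℝ) * m.factorial) with hX
      set Y : ℝ := (3 * a * g (r + (n + 1))) ^ n * τ ^ (n + 1) / ((n + 1 : ℝ) * n.factorial) *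
        (B * g (r + (n + 1))) with hY
      set Z : ℕ → ℝ := fun m => (3 * a * g (r + (m + 1)) * τ) ^ (m + 1) /
        ((m + 1).factorial : ℝ) with hZ
      set W : ℝ := (3 * a * g (r + (n + 1)) * τ) ^ (n + 1) / ((n + 1).factorial : ℝ) *
        (B * g (r + (n + 1))) with hW
      have hI : a * g r * (∫ s in (0:ℝ)..τ, (u (k - 1) s + u k s + u (k + 1) s)) ≤
          a * g r * (3 * (ε * ∑ m ∈ Finset.Ico (r - 1) n, X m + Y)) :=
        mul_le_mul_of_nonneg_left (hmono.trans_eq hPint) hagr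
      refine hI.trans ?_
      have hA : ∀ m : ℕ, a * g r * (3 * (ε * X m)) ≤ ε * Z m := by
        intro m
        have := iter_keyStep hg1 ha (hgm (Nat.le_add_right r (m + 1))) hτ0 m
        calc a * g r * (3 * (ε * X m)) = ε * (a * g r * (3 * X m)) := by ring
          _ ≤ ε * Z m := mul_le_mul_of_nonneg_left this hε
      have hB' : a * g r * (3 * Y) ≤ W := by
        have := iter_keyStep hg1 ha (hgm (Nat.le_add_right r (n + 1))) hτ0 n
        have hBg : 0 ≤ B * g (r + (n + 1)) := mul_nonneg hB (hg0 _)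
        calc a * g r * (3 * Y)
            = (a * g r * (3 * ((3 * a * g (r + (n + 1))) ^ n * τ ^ (n + 1) /
              ((n + 1 : ℝ) * n.factorial)))) * (B * g (r + (n + 1))) := by
                simp only [hY]; ring
          _ ≤ (3 * a * g (r + (n + 1)) * τ) ^ (n + 1) / ((n + 1).factorial : ℝ) *
              (B * g (r + (n + 1))) := mul_le_mul_of_nonneg_right this hBg
      have e1 : ∑ m ∈ Finset.Ico (r - 1) n, a * g r * (3 * (ε * X m)) =
          a * g r * (3 * (ε * ∑ m ∈ Finset.Ico (r - 1) n, X m)) := by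
        rw [Finset.mul_sum, Finset.mul_sum, Finset.mul_sum]
      have e2 : ∑ m ∈ Finset.Ico (r - 1) n, ε * Z m = ε * ∑ m ∈ Finset.Ico (r - 1) n, Z m := by
        rw [Finset.mul_sum]
      calc a * g r * (3 * (ε * ∑ m ∈ Finset.Ico (r - 1) n, X m + Y))
          = a * g r * (3 * (ε * ∑ m ∈ Finset.Ico (r - 1) n, X m)) + a * g r * (3 * Y) := by ring
        _ = ∑ m ∈ Finset.Ico (r - 1) n, a * g r * (3 * (ε * X m)) + a * g r * (3 * Y) := by
            rw [e1]
        _ ≤ ∑ m ∈ Finset.Ico (r - 1) n, ε * Z m + W :=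
            add_le_add (Finset.sum_le_sum fun m _ => hA m) hB'
        _ = ε * ∑ m ∈ Finset.Ico (r - 1) n, Z m + W := by rw [e2]
    -- reindex the sum: `m ↦ m + 1`
    have hreindex : ∑ m ∈ Finset.Ico (r - 1) n,
          (3 * a * g (r + (m + 1)) * τ) ^ (m + 1) / ((m + 1).factorial : ℝ) =
        ∑ m ∈ Finset.Ico (r - 1 + 1) (n + 1),
          (3 * a * g (r + m) * τ) ^ m / (m.factorial : ℝ) := by
      rw [← Finset.sum_Ico_add' (fun m => (3 * a * g (r + m) * τ) ^ m / (m.factorial : ℝ))]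
    rw [hreindex] at hmain
    by_cases hki : k = i
    · -- `r = 0`: the missing `m = 0` term is `ε ≥ u_i(0)`
      have hr0 : r = 0 := by simp [hr, hki]
      rw [hr0] at hmain ⊢
      simp only [Nat.zero_sub, zero_add] at hmain ⊢
      rw [Finset.sum_eq_sum_Ico_succ_bot (Nat.succ_pos n), pow_zero, Nat.factorial_zero,
        Nat.cast_one, div_one, mul_add, mul_one]
      have hu0 : u k 0 ≤ ε := by rw [hki]; exact hu_i
      linarith
    · have hr1 : 1 ≤ r := by
        rw [hr]; omega
      rw [Nat.sub_add_cancel hr1] at hmain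
      have hu0 : u k 0 ≤ 0 := hu_0 k hki
      linarith


/-- `c^m/m! ≤ (1/2)^m` as soon as `2 e c ≤ m` (`m ≥ 1`), from `m^m/m! ≤ e^m`. [folklore] -/
theorem pow_div_factorial_le_half_pow {c : ℝ} (hc : 0 ≤ c) {m : ℕ} (hm : 1 ≤ m)
    (h : 2 * Real.exp 1 * c ≤ m) : c ^ m / (m.factorial : ℝ) ≤ (1 / 2) ^ m := by
  have hm0 : (0 : ℝ) < m := by exact_mod_cast hm
  have he : 0 < Real.exp 1 := Real.exp_pos 1
  -- `m^m / m! ≤ e^m`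
  have h1 : (m : ℝ) ^ m / (m.factorial : ℝ) ≤ Real.exp 1 ^ m := by
    rw [Real.exp_one_pow]
    exact Real.pow_div_factorial_le_exp (m : ℝ) (Nat.cast_nonneg m) m
  have h2 : c ^ m / (m.factorial : ℝ) ≤ (c * Real.exp 1 / m) ^ m := by
    rw [div_pow, mul_pow]
    rw [le_div_iff₀ (pow_pos hm0 m)]
    calc c ^ m / (m.factorial : ℝ) * (m : ℝ) ^ m = c ^ m * ((m : ℝ) ^ m / (m.factorial : ℝ)) := by
          ring
      _ ≤ c ^ m * Real.exp 1 ^ m := by gcongr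
  refine h2.trans (pow_le_pow_left₀ (by positivity) ?_ m)
  rw [div_le_iff₀ hm0]
  linarith

/-- The remainder of the iteration tends to zero: `(1/2)^n B (3 + (r + n)) → 0`. [folklore] -/
theorem remainder_tendsto_zero (B : ℝ) (r : ℕ) :
    Tendsto (fun n : ℕ => (1 / 2 : ℝ) ^ n * (B * (3 + ((r : ℝ) + n)))) atTop (𝓝 0) := by
  have h1 : Tendsto (fun n : ℕ => (1 / 2 : ℝ) ^ n) atTop (𝓝 0) :=
    tendsto_pow_atTop_nhds_zero_of_lt_one (by norm_num) (by norm_num)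
  have h2 : Tendsto (fun n : ℕ => ((n : ℝ) ^ 1) / (2 : ℝ) ^ n) atTop (𝓝 0) :=
    tendsto_pow_const_div_const_pow_of_one_lt 1 one_lt_two
  have h3 : Tendsto (fun n : ℕ => B * (3 + (r : ℝ)) * (1 / 2 : ℝ) ^ n + B * (((n : ℝ) ^ 1) /
      (2 : ℝ) ^ n)) atTop (𝓝 (B * (3 + (r : ℝ)) * 0 + B * 0)) :=
    (h1.const_mul _).add (h2.const_mul _)
  rw [mul_zero, mul_zero, add_zero] at h3
  refine h3.congr fun n => ?_
  rw [pow_one, one_div_pow]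
  ring

/-- **Uniform bound from the iteration.** If `2e · 3a g(2m) t ≤ m` for all `m ≥ M₀` and
`g(n) ≤ 3 + n`, then every `u_k(τ)`, `τ ∈ [0,t]`, is at most `ε (e^{3a g(2M₀) t} + 2)`.
[cite: ButtaMarchioro2016, §4 eq. (4.7)] -/
theorem lattice_iteration_uniform (hg1 : ∀ n, 1 ≤ g n) (hgm : Monotone g)
    (hg3 : ∀ n : ℕ, g n ≤ 3 + n)
    (hε : 0 ≤ ε) (ha : 0 ≤ a) (hB : 0 ≤ B)
    (hu_cont : ∀ k, ContinuousOn (u k) (Icc 0 t))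
    (hu_bd : ∀ k, ∀ s ∈ Icc 0 t, u k s ≤ B * g (k - i).natAbs)
    (hu_i : u i 0 ≤ ε) (hu_0 : ∀ k, k ≠ i → u k 0 ≤ 0)
    (hu_int : ∀ k, ∀ τ ∈ Icc 0 t, u k τ ≤ u k 0 +
      a * g (k - i).natAbs * ∫ s in (0:ℝ)..τ, (u (k - 1) s + u k s + u (k + 1) s))
    {M₀ : ℕ} (hM₀ : ∀ m : ℕ, M₀ ≤ m → 2 * Real.exp 1 * (3 * a * g (2 * m) * t) ≤ m)
    (k : ℤ) {τ : ℝ} (hτ : τ ∈ Icc 0 t) :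
    u k τ ≤ ε * (Real.exp (3 * a * g (2 * M₀) * t) + 2) := by
  obtain ⟨hτ0, hτt⟩ := hτ
  have ht : 0 ≤ t := hτ0.trans hτt
  have hg0 : ∀ ρ, 0 ≤ g ρ := fun ρ => zero_le_one.trans (hg1 ρ)
  set r : ℕ := (k - i).natAbs with hr
  have hc₀0 : 0 ≤ 3 * a * g (2 * M₀) * t := by have := hg0 (2 * M₀); positivity
  set c₀ : ℝ := 3 * a * g (2 * M₀) * t with hc₀
  -- termwise bound: `T_m ≤ c₀^m/m! + (1/2)^m` for `m ≥ r`
  have hterm : ∀ m : ℕ, r ≤ m →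
      (3 * a * g (r + m) * τ) ^ m / (m.factorial : ℝ) ≤ c₀ ^ m / (m.factorial : ℝ) + (1 / 2) ^ m := by
    intro m hrm
    rcases Nat.lt_or_ge m M₀ with hlt | hge
    · -- `m < M₀`: `g(r+m) ≤ g(2 M₀)`
      have h1 : (3 * a * g (r + m) * τ) ^ m / (m.factorial : ℝ) ≤ c₀ ^ m / (m.factorial : ℝ) :=
        iterTerm_mono hg1 hgm ha (by omega) hτ0 hτt m
      have h2 : (0 : ℝ) ≤ (1 / 2) ^ m := by positivity
      linarith
    · rcases Nat.eq_zero_or_pos m with hm0 | hmpos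
      · subst hm0
        simp
      · have h1 : (3 * a * g (r + m) * τ) ^ m / (m.factorial : ℝ) ≤
            (3 * a * g (2 * m) * t) ^ m / (m.factorial : ℝ) :=
          iterTerm_mono hg1 hgm ha (by omega) hτ0 hτt m
        have h2 : (3 * a * g (2 * m) * t) ^ m / (m.factorial : ℝ) ≤ (1 / 2) ^ m :=
          pow_div_factorial_le_half_pow (by have := hg0 (2 * m); positivity) hmpos (hM₀ m hge)
        have h3 : (0 : ℝ) ≤ c₀ ^ m / (m.factorial : ℝ) := by positivity
        linarith
  -- hence the partial sums are bounded by `exp c₀ + 2`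
  have hsum : ∀ n : ℕ, ∑ m ∈ Finset.Ico r n,
      (3 * a * g (r + m) * τ) ^ m / (m.factorial : ℝ) ≤ Real.exp c₀ + 2 := by
    intro n
    calc ∑ m ∈ Finset.Ico r n, (3 * a * g (r + m) * τ) ^ m / (m.factorial : ℝ)
        ≤ ∑ m ∈ Finset.Ico r n, (c₀ ^ m / (m.factorial : ℝ) + (1 / 2) ^ m) :=
          Finset.sum_le_sum fun m hm => hterm m (Finset.mem_Ico.1 hm).1
      _ ≤ ∑ m ∈ Finset.range n, (c₀ ^ m / (m.factorial : ℝ) + (1 / 2) ^ m) :=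
          Finset.sum_le_sum_of_subset_of_nonneg
            (fun m hm => Finset.mem_range.2 (Finset.mem_Ico.1 hm).2)
            (fun m _ _ => by positivity)
      _ = ∑ m ∈ Finset.range n, c₀ ^ m / (m.factorial : ℝ) +
            ∑ m ∈ Finset.range n, (1 / 2 : ℝ) ^ m := Finset.sum_add_distrib
      _ ≤ Real.exp c₀ + 2 := add_le_add (Real.sum_le_exp_of_nonneg hc₀0 n) (sum_geometric_two_le n)
  -- the remainder is eventually `≤ (1/2)^n B (3 + (r + n))`
  have hrem : ∀ n : ℕ, max M₀ (max r 1) ≤ n →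
      (3 * a * g (r + n) * τ) ^ n / (n.factorial : ℝ) * (B * g (r + n)) ≤
        (1 / 2 : ℝ) ^ n * (B * (3 + ((r : ℝ) + n))) := by
    intro n hn
    have hM : M₀ ≤ n := le_trans (le_max_left _ _) hn
    have hrn : r ≤ n := le_trans (le_trans (le_max_left _ _) (le_max_right _ _)) hn
    have h1n : 1 ≤ n := le_trans (le_trans (le_max_right _ _) (le_max_right _ _)) hn
    have h1 : (3 * a * g (r + n) * τ) ^ n / (n.factorial : ℝ) ≤
        (3 * a * g (2 * n) * t) ^ n / (n.factorial : ℝ) :=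
      iterTerm_mono hg1 hgm ha (by omega) hτ0 hτt n
    have h2 : (3 * a * g (2 * n) * t) ^ n / (n.factorial : ℝ) ≤ (1 / 2) ^ n :=
      pow_div_factorial_le_half_pow (by have := hg0 (2 * n); positivity) h1n (hM₀ n hM)
    have h3 : g (r + n) ≤ 3 + ((r : ℝ) + n) := by
      have := hg3 (r + n); push_cast at this; linarith
    have h4 : 0 ≤ (3 * a * g (r + n) * τ) ^ n / (n.factorial : ℝ) :=
      iterTerm_nonneg hg1 ha _ hτ0 n
    calc (3 * a * g (r + n) * τ) ^ n / (n.factorial : ℝ) * (B * g (r + n))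
        ≤ (1 / 2 : ℝ) ^ n * (B * g (r + n)) :=
          mul_le_mul_of_nonneg_right (h1.trans h2) (mul_nonneg hB (hg0 _))
      _ ≤ (1 / 2 : ℝ) ^ n * (B * (3 + ((r : ℝ) + n))) := by gcongr
  -- conclude by letting `n → ∞`
  refine le_of_forall_pos_lt_add fun η hη => ?_
  have hev : ∀ᶠ n : ℕ in atTop, (1 / 2 : ℝ) ^ n * (B * (3 + ((r : ℝ) + n))) < η :=
    (remainder_tendsto_zero B r).eventually (gt_mem_nhds hη)
  obtain ⟨n, hn1, hn2⟩ := (hev.and (eventually_ge_atTop (max M₀ (max r 1)))).exists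
  have hit := lattice_iteration hg1 hgm hε ha hB hu_cont hu_bd hu_i hu_0 hu_int n k ⟨hτ0, hτt⟩
  rw [← hr] at hit
  calc u k τ ≤ ε * ∑ m ∈ Finset.Ico r n, (3 * a * g (r + m) * τ) ^ m / (m.factorial : ℝ) +
        (3 * a * g (r + n) * τ) ^ n / (n.factorial : ℝ) * (B * g (r + n)) := hit
    _ ≤ ε * (Real.exp c₀ + 2) + (1 / 2 : ℝ) ^ n * (B * (3 + ((r : ℝ) + n))) :=
        add_le_add (mul_le_mul_of_nonneg_left (hsum n) hε) (hrem n hn2)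
    _ < ε * (Real.exp c₀ + 2) + η := by linarith

/-- **Far-site bound from the iteration.** If `D = |j - i| ≥ 1` and
`2e · 3a g(2D) t ≤ D` (the "regime"), then `u_j(t) ≤ 2ε (1/2)^D`; here `g` must also satisfy
`m g(2m') ≤ m' g(2m)` for `1 ≤ m ≤ m'` (antitonicity of `g(2m)/m`) and `g(n) ≤ 3 + n`.
[cite: ButtaMarchioro2016, §4 eqs. (4.7), (4.9)] -/
theorem lattice_iteration_far (hg1 : ∀ n, 1 ≤ g n) (hgm : Monotone g)
    (hg3 : ∀ n : ℕ, g n ≤ 3 + n)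
    (hg4 : ∀ m m' : ℕ, 1 ≤ m → m ≤ m' → (m : ℝ) * g (2 * m') ≤ m' * g (2 * m))
    (ht : 0 ≤ t) (hε : 0 ≤ ε) (ha : 0 ≤ a) (hB : 0 ≤ B)
    (hu_cont : ∀ k, ContinuousOn (u k) (Icc 0 t))
    (hu_bd : ∀ k, ∀ s ∈ Icc 0 t, u k s ≤ B * g (k - i).natAbs)
    (hu_i : u i 0 ≤ ε) (hu_0 : ∀ k, k ≠ i → u k 0 ≤ 0)
    (hu_int : ∀ k, ∀ τ ∈ Icc 0 t, u k τ ≤ u k 0 +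
      a * g (k - i).natAbs * ∫ s in (0:ℝ)..τ, (u (k - 1) s + u k s + u (k + 1) s))
    {j : ℤ} (hD : 1 ≤ (j - i).natAbs)
    (hθ : 2 * Real.exp 1 * (3 * a * g (2 * (j - i).natAbs) * t) ≤ (j - i).natAbs) :
    u j t ≤ 2 * ε * (1 / 2) ^ (j - i).natAbs := by
  have hg0 : ∀ ρ, 0 ≤ g ρ := fun ρ => zero_le_one.trans (hg1 ρ)
  set D : ℕ := (j - i).natAbs with hDdef
  have hD0 : (0 : ℝ) < D := by exact_mod_cast hD
  -- in the regime every term with `m ≥ D` is at most `(1/2)^m`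
  have hterm : ∀ m : ℕ, D ≤ m →
      (3 * a * g (D + m) * t) ^ m / (m.factorial : ℝ) ≤ (1 / 2) ^ m := by
    intro m hm
    have h1m : 1 ≤ m := hD.trans hm
    have hm0 : (0 : ℝ) < m := by exact_mod_cast h1m
    have h1 : (3 * a * g (D + m) * t) ^ m / (m.factorial : ℝ) ≤
        (3 * a * g (2 * m) * t) ^ m / (m.factorial : ℝ) :=
      iterTerm_mono hg1 hgm ha (by omega) ht le_rfl m
    refine h1.trans (pow_div_factorial_le_half_pow (by have := hg0 (2 * m); positivity) h1m ?_)
    -- `2e·3a g(2m) t ≤ m` from the regime at `D` and `g(2m)/m ≤ g(2D)/D`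
    have h4 := hg4 D m hD hm
    have key : 2 * Real.exp 1 * (3 * a * g (2 * m) * t) * D ≤ (m : ℝ) * D := by
      calc 2 * Real.exp 1 * (3 * a * g (2 * m) * t) * D
          = 2 * Real.exp 1 * (3 * a * t) * ((D : ℝ) * g (2 * m)) := by ring
        _ ≤ 2 * Real.exp 1 * (3 * a * t) * ((m : ℝ) * g (2 * D)) := by
            have : 0 ≤ 2 * Real.exp 1 * (3 * a * t) := by positivity
            exact mul_le_mul_of_nonneg_left h4 this
        _ = 2 * Real.exp 1 * (3 * a * g (2 * D) * t) * m := by ring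
        _ ≤ (D : ℝ) * m := mul_le_mul_of_nonneg_right hθ (Nat.cast_nonneg m)
        _ = (m : ℝ) * D := by ring
    exact le_of_mul_le_mul_right key hD0
  have hsum : ∀ n : ℕ, ∑ m ∈ Finset.Ico D n,
      (3 * a * g (D + m) * t) ^ m / (m.factorial : ℝ) ≤ 2 * (1 / 2) ^ D := by
    intro n
    calc ∑ m ∈ Finset.Ico D n, (3 * a * g (D + m) * t) ^ m / (m.factorial : ℝ)
        ≤ ∑ m ∈ Finset.Ico D n, (1 / 2 : ℝ) ^ m :=
          Finset.sum_le_sum fun m hm => hterm m (Finset.mem_Ico.1 hm).1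
      _ = ∑ m ∈ Finset.range (n - D), (1 / 2 : ℝ) ^ (D + m) := Finset.sum_Ico_eq_sum_range _ _ _
      _ = (1 / 2 : ℝ) ^ D * ∑ m ∈ Finset.range (n - D), (1 / 2 : ℝ) ^ m := by
          rw [Finset.mul_sum]
          exact Finset.sum_congr rfl fun m _ => pow_add _ _ _
      _ ≤ (1 / 2 : ℝ) ^ D * 2 :=
          mul_le_mul_of_nonneg_left (sum_geometric_two_le _) (by positivity)
      _ = 2 * (1 / 2) ^ D := by ring
  have hrem : ∀ n : ℕ, D ≤ n →
      (3 * a * g (D + n) * t) ^ n / (n.factorial : ℝ) * (B * g (D + n)) ≤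
        (1 / 2 : ℝ) ^ n * (B * (3 + ((D : ℝ) + n))) := by
    intro n hn
    have h3 : g (D + n) ≤ 3 + ((D : ℝ) + n) := by
      have := hg3 (D + n); push_cast at this; linarith
    calc (3 * a * g (D + n) * t) ^ n / (n.factorial : ℝ) * (B * g (D + n))
        ≤ (1 / 2 : ℝ) ^ n * (B * g (D + n)) :=
          mul_le_mul_of_nonneg_right (hterm n hn) (mul_nonneg hB (hg0 _))
      _ ≤ (1 / 2 : ℝ) ^ n * (B * (3 + ((D : ℝ) + n))) := by gcongr
  refine le_of_forall_pos_lt_add fun η hη => ?_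
  have hev : ∀ᶠ n : ℕ in atTop, (1 / 2 : ℝ) ^ n * (B * (3 + ((D : ℝ) + n))) < η :=
    (remainder_tendsto_zero B D).eventually (gt_mem_nhds hη)
  obtain ⟨n, hn1, hn2⟩ := (hev.and (eventually_ge_atTop D)).exists
  have hit := lattice_iteration hg1 hgm hε ha hB hu_cont hu_bd hu_i hu_0 hu_int n j
    ⟨ht, le_rfl⟩
  rw [← hDdef] at hit
  calc u j t ≤ ε * ∑ m ∈ Finset.Ico D n, (3 * a * g (D + m) * t) ^ m / (m.factorial : ℝ) +
        (3 * a * g (D + n) * t) ^ n / (n.factorial : ℝ) * (B * g (D + n)) := hit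
    _ ≤ ε * (2 * (1 / 2) ^ D) + (1 / 2 : ℝ) ^ n * (B * (3 + ((D : ℝ) + n))) :=
        add_le_add (mul_le_mul_of_nonneg_left (hsum n) hε) (hrem n hn2)
    _ < 2 * ε * (1 / 2) ^ D + η := by linarith



/-! ### The weight `g(n) = 1 + log(e + n)` -/

/-- `1 ≤ 1 + log(e + n)`. [folklore] -/
theorem g_one_le (n : ℕ) : 1 ≤ 1 + Real.log (Real.exp 1 + n) := by
  have : 0 ≤ Real.log (Real.exp 1 + n) := Real.log_nonneg (by linarith [Real.add_one_le_exp 1])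
  linarith

/-- Monotonicity of `n ↦ 1 + log(e + n)`. [folklore] -/
theorem g_monotone : Monotone fun n : ℕ => 1 + Real.log (Real.exp 1 + n) := by
  intro m n hmn
  have hpos : 0 < Real.exp 1 + m := by positivity
  simp only
  have hmn' : (m : ℝ) ≤ n := by exact_mod_cast hmn
  have : Real.log (Real.exp 1 + m) ≤ Real.log (Real.exp 1 + n) :=
    Real.log_le_log hpos (by linarith)
  linarith

/-- `1 + log(e + n) ≤ 3 + n`. [folklore] -/
theorem g_le (n : ℕ) : 1 + Real.log (Real.exp 1 + n) ≤ 3 + n := by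
  have h1 := Real.log_le_sub_one_of_pos (show 0 < Real.exp 1 + n by positivity)
  have h2 : Real.exp 1 < 3 := lt_trans Real.exp_one_lt_d9 (by norm_num)
  linarith

/-- Antitonicity of `g(2m)/m`: `m g(2m') ≤ m' g(2m)` for `1 ≤ m ≤ m'`. [folklore] -/
theorem g_antitone {m m' : ℕ} (hm : 1 ≤ m) (hmm' : m ≤ m') :
    (m : ℝ) * (1 + Real.log (Real.exp 1 + (2 * m' : ℕ))) ≤
      m' * (1 + Real.log (Real.exp 1 + (2 * m : ℕ))) := by
  have hm1 : (1 : ℝ) ≤ m := by exact_mod_cast hm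
  have hmm : (m : ℝ) ≤ m' := by exact_mod_cast hmm'
  set x : ℝ := Real.exp 1 + (2 * m : ℕ) with hx
  set y : ℝ := Real.exp 1 + (2 * m' : ℕ) with hy
  have he : 0 < Real.exp 1 := Real.exp_pos 1
  have hx0 : 0 < x := by rw [hx]; positivity
  have hxy : x ≤ y := by rw [hx, hy]; push_cast; linarith
  have hy0 : 0 < y := hx0.trans_le hxy
  -- `log y - log x ≤ (y - x)/x`
  have hlog : Real.log y - Real.log x ≤ (y - x) / x := by
    have := Real.log_le_sub_one_of_pos (div_pos hy0 hx0)
    rw [Real.log_div hy0.ne' hx0.ne'] at this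
    rw [le_div_iff₀ hx0]
    rw [div_sub_one hx0.ne', le_div_iff₀ hx0] at this
    exact this
  have hyx : y - x = 2 * ((m' : ℝ) - m) := by rw [hx, hy]; push_cast; ring
  have hlx : 1 ≤ Real.log x := by
    rw [Real.le_log_iff_exp_le hx0, hx]; push_cast; linarith
  -- `m (log y - log x) ≤ m' - m`
  have hkey : (m : ℝ) * (Real.log y - Real.log x) ≤ (m' : ℝ) - m := by
    have h1 : (m : ℝ) * (Real.log y - Real.log x) ≤ m * ((y - x) / x) :=
      mul_le_mul_of_nonneg_left hlog (by linarith)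
    have h2 : (m : ℝ) * ((y - x) / x) ≤ (m' : ℝ) - m := by
      rw [hyx, mul_div_assoc', div_le_iff₀ hx0, hx]
      push_cast
      nlinarith
    linarith
  nlinarith

/-- `log(e + |k|) ≤ log(e + |i|) (1 + log(e + |k - i|))`. [folklore] -/
theorem log_site_le (i k : ℤ) :
    Real.log (Real.exp 1 + |(k : ℝ)|) ≤
      Real.log (Real.exp 1 + |(i : ℝ)|) * (1 + Real.log (Real.exp 1 + ((k - i).natAbs : ℕ))) := by
  have he1 : 1 ≤ Real.exp 1 := by linarith [Real.add_one_le_exp (1:ℝ)]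
  have hki : (((k - i).natAbs : ℕ) : ℝ) = |(k : ℝ) - i| := by
    rw [Nat.cast_natAbs]; push_cast; rfl
  rw [hki]
  have hLi : 1 ≤ Real.log (Real.exp 1 + |(i : ℝ)|) := by
    rw [Real.le_log_iff_exp_le (by positivity)]; linarith [abs_nonneg (i : ℝ)]
  have hLki : 0 ≤ Real.log (Real.exp 1 + |(k : ℝ) - i|) :=
    Real.log_nonneg (by linarith [abs_nonneg ((k : ℝ) - i)])
  have hprod : Real.exp 1 + |(k : ℝ)| ≤ (Real.exp 1 + |(i : ℝ)|) * (Real.exp 1 + |(k : ℝ) - i|) := by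
    have htri : |(k : ℝ)| ≤ |(i : ℝ)| + |(k : ℝ) - i| := by
      have := abs_add_le (i : ℝ) ((k : ℝ) - i); rwa [add_sub_cancel] at this
    have ha := abs_nonneg (i : ℝ); have hb := abs_nonneg ((k : ℝ) - i)
    nlinarith
  calc Real.log (Real.exp 1 + |(k : ℝ)|)
      ≤ Real.log ((Real.exp 1 + |(i : ℝ)|) * (Real.exp 1 + |(k : ℝ) - i|)) :=
        Real.log_le_log (by positivity) hprod
    _ = Real.log (Real.exp 1 + |(i : ℝ)|) + Real.log (Real.exp 1 + |(k : ℝ) - i|) :=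
        Real.log_mul (by positivity) (by positivity)
    _ ≤ Real.log (Real.exp 1 + |(i : ℝ)|) * (1 + Real.log (Real.exp 1 + |(k : ℝ) - i|)) := by
        nlinarith

/-- A threshold beyond which `c (1 + log(e + 2m)) ≤ m`. [folklore] -/
theorem exists_threshold (c : ℝ) :
    ∃ M₀ : ℕ, ∀ m : ℕ, M₀ ≤ m → c * (1 + Real.log (Real.exp 1 + (2 * m : ℕ))) ≤ m := by
  rcases le_or_gt c 0 with hc | hc
  · refine ⟨0, fun m _ => ?_⟩
    have : 0 ≤ 1 + Real.log (Real.exp 1 + (2 * m : ℕ)) := zero_le_one.trans (g_one_le _)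
    have hm : (0 : ℝ) ≤ m := Nat.cast_nonneg m
    nlinarith
  · refine ⟨⌈(Real.exp 1 + 4 * c * Real.log (4 * c)) / 2⌉₊, fun m hm => ?_⟩
    have hm' : (Real.exp 1 + 4 * c * Real.log (4 * c)) / 2 ≤ m :=
      le_trans (Nat.le_ceil _) (by exact_mod_cast hm)
    have hpos : 0 < Real.exp 1 + (2 * m : ℕ) := by positivity
    have hK : 0 < 4 * c := by positivity
    -- `log y ≤ y/K - 1 + log K`
    have hlog : Real.log (Real.exp 1 + (2 * m : ℕ)) ≤
        (Real.exp 1 + (2 * m : ℕ)) / (4 * c) - 1 + Real.log (4 * c) := by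
      have := Real.log_le_sub_one_of_pos (div_pos hpos hK)
      rw [Real.log_div hpos.ne' hK.ne'] at this
      linarith
    have : c * (1 + Real.log (Real.exp 1 + (2 * m : ℕ))) ≤
        (Real.exp 1 + (2 * m : ℕ)) / 4 + c * Real.log (4 * c) := by
      have h1 := mul_le_mul_of_nonneg_left hlog hc.le
      have h2 : c * ((Real.exp 1 + (2 * m : ℕ)) / (4 * c)) = (Real.exp 1 + (2 * m : ℕ)) / 4 := by
        field_simp
      nlinarith
    push_cast at this hm' ⊢
    linarith

/-- **Derivatives are bounded by local Lipschitz constants** (junk-free: if `φ` is not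
differentiable at `p`, `deriv φ p = 0`). [folklore] -/
theorem abs_deriv_le_of_lip {φ : ℝ → ℝ} {p K : ℝ} (hK : 0 ≤ K)
    (h : ∀ᶠ s in 𝓝 p, |φ s - φ p| ≤ K * |s - p|) : |deriv φ p| ≤ K := by
  by_cases hd : DifferentiableAt ℝ φ p
  · have := hd.hasDerivAt.le_of_lip' hK (by simpa only [Real.norm_eq_abs] using h)
    simpa only [Real.norm_eq_abs] using this
  · rw [deriv_zero_of_not_differentiableAt hd, abs_zero]
    exact hK

/-- A function with derivative bounded by `M` everywhere is `M`-Lipschitz. [folklore] -/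
theorem lipschitz_of_fderiv_le {g : ℝ × ℝ → ℝ} (hg : Differentiable ℝ g) {M : ℝ}
    (hM : ∀ z, ‖fderiv ℝ g z‖ ≤ M) (z w : ℝ × ℝ) : |g w - g z| ≤ M * ‖w - z‖ := by
  have := (convex_univ (𝕜 := ℝ) (E := ℝ × ℝ)).norm_image_sub_le_of_norm_fderiv_le
    (fun x _ => hg x) (fun x _ => hM x) (Set.mem_univ z) (Set.mem_univ w)
  simpa only [Real.norm_eq_abs] using this

end BMLightCone

namespace OscillatorChain

namespace IsEvenPolyOfDegree

variable {f : ℝ → ℝ} {s : ℕ}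

/-- Growth of an even polynomial: `f(x) ≤ A₀ (1 + |x|^{2s})`. [folklore] -/
theorem le_const_mul (h : IsEvenPolyOfDegree f s) :
    ∃ A₀ : ℝ, 0 ≤ A₀ ∧ ∀ x, f x ≤ A₀ * (1 + |x| ^ (2 * s)) := by
  obtain ⟨a, -, hf, -⟩ := h
  refine ⟨∑ m ∈ range (s + 1), |a m|, Finset.sum_nonneg fun m _ => abs_nonneg _, fun x => ?_⟩
  rw [hf x, Finset.sum_mul]
  refine Finset.sum_le_sum fun m hm => ?_
  have hms : m ≤ s := Nat.lt_succ_iff.1 (Finset.mem_range.1 hm)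
  calc a m * x ^ (2 * m) ≤ |a m * x ^ (2 * m)| := le_abs_self _
    _ = |a m| * |x| ^ (2 * m) := by rw [abs_mul, abs_pow]
    _ ≤ |a m| * (1 + |x| ^ (2 * s)) :=
        mul_le_mul_of_nonneg_left (abs_pow_le_one_add_abs_pow x (by omega)) (abs_nonneg _)

/-- **Local Lipschitz bound for the derivative of an even polynomial**, in the cruder form used
here: `|f'(y) - f'(x)| ≤ A₂ (1 + |x|^{2s} + |y|^{2s}) |y - x|` (from
`exists_abs_deriv_sub_deriv_le` of `EvenPolynomialPotentials`). [folklore] -/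
theorem lipschitz_deriv (h : IsEvenPolyOfDegree f s) :
    ∃ A₂ : ℝ, 0 ≤ A₂ ∧ ∀ x y : ℝ,
      |deriv f y - deriv f x| ≤ A₂ * (1 + |x| ^ (2 * s) + |y| ^ (2 * s)) * |y - x| := by
  obtain ⟨C, hC, hL⟩ := h.exists_abs_deriv_sub_deriv_le
  refine ⟨3 * C, by positivity, fun x y => ?_⟩
  refine (hL y x).trans ?_
  have hx := abs_pow_le_one_add_abs_pow x (show 2 * s - 2 ≤ 2 * s by omega)
  have hy := abs_pow_le_one_add_abs_pow y (show 2 * s - 2 ≤ 2 * s by omega)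
  have h0 : 0 ≤ |y - x| := abs_nonneg _
  have hxs : 0 ≤ |x| ^ (2 * s) := by positivity
  have hys : 0 ≤ |y| ^ (2 * s) := by positivity
  apply mul_le_mul_of_nonneg_right _ h0
  nlinarith

/-- **Coercivity of an even polynomial with positive leading coefficient**, in the form
`|x|^{2s} ≤ K₀ (1 + f(x))` (from `exists_coercive` of `EvenPolynomialPotentials`). [folklore] -/
theorem pow_le (h : IsEvenPolyOfDegree f s) :
    ∃ K₀ : ℝ, 0 < K₀ ∧ ∀ x : ℝ, |x| ^ (2 * s) ≤ K₀ * (1 + f x) := by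
  obtain ⟨c, C, hc, hC, hco⟩ := h.exists_coercive
  have hf0 := h.nonneg
  refine ⟨(C + 1) / c, by positivity, fun x => ?_⟩
  have h1 := hco x
  have h2 := hf0 x
  rw [div_mul_eq_mul_div, le_div_iff₀ hc]
  nlinarith

/-- **Perturbation bound**: `|y - x| ≤ 2` implies `f(y) ≤ K₂ (1 + f(x))`. [folklore] -/
theorem perturb_le (h : IsEvenPolyOfDegree f s) :
    ∃ K₂ : ℝ, 0 < K₂ ∧ ∀ x y : ℝ, |y - x| ≤ 2 → f y ≤ K₂ * (1 + f x) := by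
  obtain ⟨A₀, hA₀, hup⟩ := h.le_const_mul
  obtain ⟨K₀, hK₀, hco⟩ := h.pow_le
  obtain ⟨-, -, -, hf0⟩ := h
  refine ⟨A₀ * (1 + 2 ^ (2 * s) * K₀ + 2 ^ (2 * s) * 2 ^ (2 * s)) + 1, by positivity,
    fun x y hxy => ?_⟩
  have hy : |y| ≤ |x| + 2 := by
    have := abs_sub_abs_le_abs_sub y x
    linarith
  -- `|y|^{2s} ≤ 2^{2s} (|x|^{2s} + 2^{2s})`
  have hy2 : |y| ^ (2 * s) ≤ 2 ^ (2 * s) * (|x| ^ (2 * s) + 2 ^ (2 * s)) := by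
    have hmax : |x| + 2 ≤ 2 * max |x| 2 := by
      rcases le_total |x| 2 with h2 | h2
      · rw [max_eq_right h2]; linarith
      · rw [max_eq_left h2]; linarith
    have h1 : |y| ^ (2 * s) ≤ (2 * max |x| 2) ^ (2 * s) :=
      pow_le_pow_left₀ (abs_nonneg y) (hy.trans hmax) _
    have h2 : (max |x| 2) ^ (2 * s) ≤ |x| ^ (2 * s) + 2 ^ (2 * s) := by
      rcases le_total |x| 2 with h2 | h2
      · rw [max_eq_right h2]
        have : 0 ≤ |x| ^ (2 * s) := by positivity
        linarith
      · rw [max_eq_left h2]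
        have : (0 : ℝ) ≤ 2 ^ (2 * s) := by positivity
        linarith
    calc |y| ^ (2 * s) ≤ (2 * max |x| 2) ^ (2 * s) := h1
      _ = 2 ^ (2 * s) * (max |x| 2) ^ (2 * s) := mul_pow _ _ _
      _ ≤ 2 ^ (2 * s) * (|x| ^ (2 * s) + 2 ^ (2 * s)) :=
          mul_le_mul_of_nonneg_left h2 (by positivity)
  have hx2 := hco x
  have hfx : 0 ≤ f x := hf0 x
  calc f y ≤ A₀ * (1 + |y| ^ (2 * s)) := hup y
    _ ≤ A₀ * (1 + 2 ^ (2 * s) * (K₀ * (1 + f x) + 2 ^ (2 * s))) := by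
        gcongr
        calc |y| ^ (2 * s) ≤ 2 ^ (2 * s) * (|x| ^ (2 * s) + 2 ^ (2 * s)) := hy2
          _ ≤ 2 ^ (2 * s) * (K₀ * (1 + f x) + 2 ^ (2 * s)) := by gcongr
    _ = A₀ * (1 + 2 ^ (2 * s) * 2 ^ (2 * s)) + A₀ * (2 ^ (2 * s) * K₀) * (1 + f x) := by ring
    _ ≤ A₀ * (1 + 2 ^ (2 * s) * 2 ^ (2 * s)) * (1 + f x) +
          A₀ * (2 ^ (2 * s) * K₀) * (1 + f x) + 1 * (1 + f x) := by
        have h1 : A₀ * (1 + 2 ^ (2 * s) * 2 ^ (2 * s)) ≤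
            A₀ * (1 + 2 ^ (2 * s) * 2 ^ (2 * s)) * (1 + f x) :=
          le_mul_of_one_le_right (by positivity) (by linarith)
        have h2 : 0 ≤ 1 * (1 + f x) := by positivity
        linarith
    _ = (A₀ * (1 + 2 ^ (2 * s) * K₀ + 2 ^ (2 * s) * 2 ^ (2 * s)) + 1) * (1 + f x) := by ring

end IsEvenPolyOfDegree


/-! ### Section C: bookkeeping for `W_{μ,k}`, `Q` and `𝒳₀` -/

variable (P : OscillatorChain)

/-- `W_{μ,k} ≥ 2k+1` when `U, V ≥ 0` (each site contributes at least `1`). [cite: ButtaMarchioro2016, §2 eq. (2.4)] -/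
private theorem lc_bmLocalEnergy_ge (hU0 : ∀ x, 0 ≤ P.U x) (hV0 : ∀ x, 0 ≤ P.V x) (μ : ℤ) (k : ℕ)
    (σ : ChainConfig) : (2 * (k : ℝ) + 1) ≤ P.bmLocalEnergy μ k σ := by
  unfold bmLocalEnergy
  have hcard : (Finset.Icc (μ - k) (μ + k)).card = 2 * k + 1 := by
    rw [Int.card_Icc]; omega
  have h1 : (2 * (k : ℝ) + 1) ≤
      ∑ i ∈ Finset.Icc (μ - k) (μ + k), ((σ i).2 ^ 2 / 2 + P.U (σ i).1 + 1) := by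
    calc (2 * (k : ℝ) + 1) = ∑ i ∈ Finset.Icc (μ - k) (μ + k), (1 : ℝ) := by
          rw [Finset.sum_const, nsmul_eq_mul, mul_one, hcard]; push_cast; ring
      _ ≤ _ := Finset.sum_le_sum fun i _ => by
          have := hU0 (σ i).1; nlinarith [sq_nonneg (σ i).2]
  have h2 : 0 ≤ ∑ i ∈ Finset.Icc (μ - k) (μ + k), ∑ j ∈ Finset.Icc (μ - k) (μ + k),
      (if |j - i| = 1 then P.V ((σ i).1 - (σ j).1) else 0) :=
    Finset.sum_nonneg fun i _ => Finset.sum_nonneg fun j _ => by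
      split_ifs
      · exact hV0 _
      · exact le_rfl
  linarith

/-- `W_{0,2}/5` belongs to the growth set (as `log(e + 0) = 1 < 2`). [cite: ButtaMarchioro2016, §2 eq. (2.5)] -/
private theorem lc_mem_bmGrowthSet_zero_two (σ : ChainConfig) :
    P.bmLocalEnergy 0 2 σ / (2 * ((2 : ℕ) : ℝ) + 1) ∈ P.bmGrowthSet σ :=
  ⟨0, 2, by simp, rfl⟩

/-- The growth set is non-empty. [cite: ButtaMarchioro2016, §2 eq. (2.5)] -/
private theorem lc_bmGrowthSet_nonempty (σ : ChainConfig) : (P.bmGrowthSet σ).Nonempty :=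
  ⟨_, P.lc_mem_bmGrowthSet_zero_two σ⟩

/-- `Q ≥ 1` on `𝒳₀` (BM: "using that `Q(x) ≥ 1`"). [cite: ButtaMarchioro2016, §3 (after eq. (3.9))] -/
private theorem lc_one_le_bmGrowth (hU0 : ∀ x, 0 ≤ P.U x) (hV0 : ∀ x, 0 ≤ P.V x) {σ : ChainConfig}
    (hσ : σ ∈ P.bmGood) : 1 ≤ P.bmGrowth σ := by
  refine le_trans ?_ (le_csSup hσ (P.lc_mem_bmGrowthSet_zero_two σ))
  rw [le_div_iff₀ (by norm_num)]
  have := P.lc_bmLocalEnergy_ge hU0 hV0 0 2 σ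
  push_cast at this ⊢
  linarith

/-- Elements of the growth set are bounded by `Q` on `𝒳₀`. [cite: ButtaMarchioro2016, §2 eq. (2.5)] -/
private theorem lc_le_bmGrowth {σ : ChainConfig} (hσ : σ ∈ P.bmGood) {r : ℝ} (hr : r ∈ P.bmGrowthSet σ) :
    r ≤ P.bmGrowth σ :=
  le_csSup hσ hr

/-- `Q ≤ M` as soon as every normalised local energy is `≤ M`. [cite: ButtaMarchioro2016, §2 eq. (2.5)] -/
private theorem lc_bmGrowth_le {σ : ChainConfig} {M : ℝ} (h : ∀ r ∈ P.bmGrowthSet σ, r ≤ M) :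
    P.bmGrowth σ ≤ M :=
  csSup_le (P.lc_bmGrowthSet_nonempty σ) h

/-- `1 ≤ log(e + |k|)`. [folklore] -/
private theorem lc_one_le_log_e_add (k : ℤ) : 1 ≤ Real.log (Real.exp 1 + |(k : ℝ)|) := by
  rw [Real.le_log_iff_exp_le (by positivity)]
  linarith [abs_nonneg (k : ℝ)]

/-- **Site bound from `Q`.** If every normalised local energy of `σ` is `≤ M`, then for every
site `k`, `p_k²/2 + U(q_k) + 1 + V(q_{k+1} - q_k) + V(q_k - q_{k-1}) ≤ 5 log(e + |k|) M`
(take the box `Λ_{k,n}`, `n = ⌊log(e+|k|)⌋ + 1`). [cite: ButtaMarchioro2016, §4 eq. (4.6)] -/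
theorem lc_site_le (hU0 : ∀ x, 0 ≤ P.U x) (hV0 : ∀ x, 0 ≤ P.V x) {σ : ChainConfig} {M : ℝ}
    (hM : ∀ r ∈ P.bmGrowthSet σ, r ≤ M) (k : ℤ) :
    (σ k).2 ^ 2 / 2 + P.U (σ k).1 + 1 + P.V ((σ (k + 1)).1 - (σ k).1) +
        P.V ((σ k).1 - (σ (k - 1)).1) ≤ 5 * Real.log (Real.exp 1 + |(k : ℝ)|) * M := by
  set ℓ : ℝ := Real.log (Real.exp 1 + |(k : ℝ)|) with hℓ
  have hℓ1 : 1 ≤ ℓ := lc_one_le_log_e_add k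
  set n : ℕ := ⌊ℓ⌋₊ + 1 with hn
  have hnℓ : ℓ < n := by rw [hn]; push_cast; exact Nat.lt_floor_add_one ℓ
  have hnℓ' : (n : ℝ) ≤ ℓ + 1 := by
    rw [hn]; push_cast; linarith [Nat.floor_le (zero_le_one.trans hℓ1)]
  have hn1 : 1 ≤ n := Nat.le_add_left 1 _
  have hmem : P.bmLocalEnergy k n σ / (2 * (n : ℝ) + 1) ∈ P.bmGrowthSet σ := ⟨k, n, hnℓ, rfl⟩
  have hW := hM _ hmem
  have hpos : (0 : ℝ) < 2 * (n : ℝ) + 1 := by positivity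
  rw [div_le_iff₀ hpos] at hW
  have hWge := P.lc_bmLocalEnergy_ge hU0 hV0 k n σ
  have hM0 : 0 ≤ M := by nlinarith
  -- the lower bound on `W_{k,n}` by the terms at `k`, `(k+1,k)`, `(k,k-1)`
  have hk : k ∈ Finset.Icc (k - n) (k + n) := by simp
  have hk1 : k + 1 ∈ Finset.Icc (k - n) (k + n) := by
    simp only [Finset.mem_Icc]; constructor <;> omega
  have hk2 : k - 1 ∈ Finset.Icc (k - n) (k + n) := by
    simp only [Finset.mem_Icc]; constructor <;> omega
  have hsite : (σ k).2 ^ 2 / 2 + P.U (σ k).1 + 1 ≤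
      ∑ i ∈ Finset.Icc (k - n) (k + n), ((σ i).2 ^ 2 / 2 + P.U (σ i).1 + 1) :=
    Finset.single_le_sum (f := fun i => (σ i).2 ^ 2 / 2 + P.U (σ i).1 + 1)
      (fun i _ => by have := hU0 (σ i).1; positivity) hk
  have hT0 : ∀ i j : ℤ, 0 ≤ (if |j - i| = 1 then P.V ((σ i).1 - (σ j).1) else 0) := by
    intro i j; split_ifs
    · exact hV0 _
    · exact le_rfl
  have hbond : P.V ((σ (k + 1)).1 - (σ k).1) + P.V ((σ k).1 - (σ (k - 1)).1) ≤
      ∑ i ∈ Finset.Icc (k - n) (k + n), ∑ j ∈ Finset.Icc (k - n) (k + n),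
        (if |j - i| = 1 then P.V ((σ i).1 - (σ j).1) else 0) := by
    have hin1 : P.V ((σ (k + 1)).1 - (σ k).1) ≤ ∑ j ∈ Finset.Icc (k - n) (k + n),
        (if |j - (k + 1)| = 1 then P.V ((σ (k + 1)).1 - (σ j).1) else 0) := by
      have := Finset.single_le_sum
        (f := fun j => (if |j - (k + 1)| = 1 then P.V ((σ (k + 1)).1 - (σ j).1) else 0))
        (fun j _ => hT0 (k + 1) j) hk
      simpa using this
    have hin2 : P.V ((σ k).1 - (σ (k - 1)).1) ≤ ∑ j ∈ Finset.Icc (k - n) (k + n),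
        (if |j - k| = 1 then P.V ((σ k).1 - (σ j).1) else 0) := by
      have := Finset.single_le_sum
        (f := fun j => (if |j - k| = 1 then P.V ((σ k).1 - (σ j).1) else 0))
        (fun j _ => hT0 k j) hk2
      simpa using this
    have hsub : ({k, k + 1} : Finset ℤ) ⊆ Finset.Icc (k - n) (k + n) := by
      intro i hi
      simp only [Finset.mem_insert, Finset.mem_singleton] at hi
      rcases hi with rfl | rfl
      · exact hk
      · exact hk1
    have hpair := Finset.sum_le_sum_of_subset_of_nonneg hsub
      (f := fun i => ∑ j ∈ Finset.Icc (k - n) (k + n),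
        (if |j - i| = 1 then P.V ((σ i).1 - (σ j).1) else 0))
      (fun i _ _ => Finset.sum_nonneg fun j _ => hT0 i j)
    rw [Finset.sum_pair (by omega : k ≠ k + 1)] at hpair
    linarith
  have hW' : P.bmLocalEnergy k n σ ≤ 5 * ℓ * M := by
    calc P.bmLocalEnergy k n σ ≤ M * (2 * (n : ℝ) + 1) := hW
      _ ≤ M * (5 * ℓ) := by apply mul_le_mul_of_nonneg_left _ hM0; linarith
      _ = 5 * ℓ * M := by ring
  unfold bmLocalEnergy at hW'
  linarith

/-- The second component of a pair is controlled by the sup norm. [folklore] -/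
private theorem lc_abs_snd_sub_le (z w : ℝ × ℝ) : |z.2 - w.2| ≤ ‖z - w‖ := by
  have := norm_snd_le (z - w)
  simpa [Real.norm_eq_abs] using this

/-- The first component of a pair is controlled by the sup norm. [folklore] -/
private theorem lc_abs_fst_sub_le (z w : ℝ × ℝ) : |z.1 - w.1| ≤ ‖z - w‖ := by
  have := norm_fst_le (z - w)
  simpa [Real.norm_eq_abs] using this

/-- **One-site modifications stay in `𝒳₀`, quantitatively.** For `σ` and a site `i` there is
`c ≥ 0` such that replacing `σ_i` by any `z` with `‖z - σ_i‖ ≤ 1` changes no `W_{μ,k}` by more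
than `c (2k+1)`. [folklore] -/
theorem bmLocalEnergy_update_le {s₁ s₂ : ℕ} (hU : IsEvenPolyOfDegree P.U s₁)
    (hV : IsEvenPolyOfDegree P.V s₂) (σ : ChainConfig) (i : ℤ) :
    ∃ c : ℝ, 0 ≤ c ∧ ∀ z : ℝ × ℝ, ‖z - σ i‖ ≤ 1 → ∀ (μ : ℤ) (k : ℕ),
      P.bmLocalEnergy μ k (Function.update σ i z) ≤ P.bmLocalEnergy μ k σ + c * (2 * k + 1) := by
  obtain ⟨KU, hKU, hKUb⟩ := hU.perturb_le
  obtain ⟨KV, hKV, hKVb⟩ := hV.perturb_le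
  have hU0 := hU.nonneg
  have hV0 := hV.nonneg
  -- the constants
  set c₁ : ℝ := (|(σ i).2| + 1) ^ 2 / 2 + KU * (1 + P.U (σ i).1) + 1 with hc₁
  set c₂ : ℝ := KV * (1 + P.V ((σ i).1 - (σ (i + 1)).1)) + KV * (1 + P.V ((σ i).1 - (σ (i - 1)).1)) +
    KV * (1 + P.V ((σ (i + 1)).1 - (σ i).1)) + KV * (1 + P.V ((σ (i - 1)).1 - (σ i).1)) with hc₂
  have hc₁0 : 0 ≤ c₁ := by have := hU0 (σ i).1; positivity
  have hV1 : ∀ x, 0 ≤ KV * (1 + P.V x) := fun x => by have := hV0 x; positivity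
  have hc₂0 : 0 ≤ c₂ := by
    have := hV1 ((σ i).1 - (σ (i + 1)).1); have := hV1 ((σ i).1 - (σ (i - 1)).1)
    have := hV1 ((σ (i + 1)).1 - (σ i).1); have := hV1 ((σ (i - 1)).1 - (σ i).1)
    linarith
  refine ⟨c₁ + 2 * c₂, by positivity, fun z hz μ k => ?_⟩
  set σ' := Function.update σ i z with hσ'
  have hσ'i : σ' i = z := by simp [hσ']
  have hσ'ne : ∀ l, l ≠ i → σ' l = σ l := fun l hl => by simp [hσ', hl]
  have hz1 : |z.1 - (σ i).1| ≤ 1 := (lc_abs_fst_sub_le z (σ i)).trans hz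
  have hz2 : |z.2 - (σ i).2| ≤ 1 := (lc_abs_snd_sub_le z (σ i)).trans hz
  -- site terms
  have hsite : ∀ l : ℤ, ((σ' l).2 ^ 2 / 2 + P.U (σ' l).1 + 1) - ((σ l).2 ^ 2 / 2 + P.U (σ l).1 + 1)
      ≤ if l = i then c₁ else 0 := by
    intro l
    by_cases hl : l = i
    · subst hl
      rw [if_pos rfl, hσ'i]
      have h1 : |z.2| ≤ |(σ l).2| + 1 := by
        have := abs_sub_abs_le_abs_sub z.2 (σ l).2; linarith
      have h2 : z.2 ^ 2 ≤ (|(σ l).2| + 1) ^ 2 := by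
        calc z.2 ^ 2 = |z.2| ^ 2 := (sq_abs _).symm
          _ ≤ (|(σ l).2| + 1) ^ 2 := pow_le_pow_left₀ (abs_nonneg _) h1 2
      have h3 : P.U z.1 ≤ KU * (1 + P.U (σ l).1) := hKUb _ _ (hz1.trans (by norm_num))
      have h4 : 0 ≤ (σ l).2 ^ 2 / 2 + P.U (σ l).1 := by have := hU0 (σ l).1; positivity
      rw [hc₁]; linarith
    · rw [if_neg hl, hσ'ne l hl]; simp
  -- bond terms
  have hbond : ∀ l l' : ℤ,
      (if |l' - l| = 1 then P.V ((σ' l).1 - (σ' l').1) else 0) -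
        (if |l' - l| = 1 then P.V ((σ l).1 - (σ l').1) else 0) ≤
      (if l = i then c₂ else 0) + (if l' = i then c₂ else 0) := by
    intro l l'
    by_cases hll : |l' - l| = 1
    · rw [if_pos hll, if_pos hll]
      by_cases hl : l = i
      · subst hl
        have hl' : l' ≠ l := by intro h; rw [h, sub_self, abs_zero] at hll; exact zero_ne_one hll
        rw [if_pos rfl, if_neg hl', hσ'i, hσ'ne l' hl', add_zero]
        have hV0' := hV0 ((σ l).1 - (σ l').1)
        -- `l' = l + 1` or `l' = l - 1`
        have hcases : l' = l + 1 ∨ l' = l - 1 := by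
          rcases abs_eq (zero_le_one' ℤ) |>.1 hll with h | h <;> [left; right] <;> omega
        have hbd : P.V (z.1 - (σ l').1) ≤ KV * (1 + P.V ((σ l).1 - (σ l').1)) :=
          hKVb _ _ (by
            have : z.1 - (σ l').1 - ((σ l).1 - (σ l').1) = z.1 - (σ l).1 := by ring
            rw [this]; exact hz1.trans (by norm_num))
        rcases hcases with rfl | rfl
        · have := hV1 ((σ l).1 - (σ (l - 1)).1); have := hV1 ((σ (l + 1)).1 - (σ l).1)
          have := hV1 ((σ (l - 1)).1 - (σ l).1)
          rw [hc₂]; linarith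
        · have := hV1 ((σ l).1 - (σ (l + 1)).1); have := hV1 ((σ (l + 1)).1 - (σ l).1)
          have := hV1 ((σ (l - 1)).1 - (σ l).1)
          rw [hc₂]; linarith
      · rw [if_neg hl, zero_add, hσ'ne l hl]
        by_cases hl' : l' = i
        · subst hl'
          rw [if_pos rfl, hσ'i]
          have hV0' := hV0 ((σ l).1 - (σ l').1)
          have hcases : l = l' + 1 ∨ l = l' - 1 := by
            rcases abs_eq (zero_le_one' ℤ) |>.1 hll with h | h <;> [right; left] <;> omega
          have hbd : P.V ((σ l).1 - z.1) ≤ KV * (1 + P.V ((σ l).1 - (σ l').1)) :=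
            hKVb _ _ (by
              have : (σ l).1 - z.1 - ((σ l).1 - (σ l').1) = -(z.1 - (σ l').1) := by ring
              rw [this, abs_neg]; exact hz1.trans (by norm_num))
          rcases hcases with rfl | rfl
          · have := hV1 ((σ l').1 - (σ (l' + 1)).1); have := hV1 ((σ l').1 - (σ (l' - 1)).1)
            have := hV1 ((σ (l' - 1)).1 - (σ l').1)
            rw [hc₂]; linarith
          · have := hV1 ((σ l').1 - (σ (l' + 1)).1); have := hV1 ((σ l').1 - (σ (l' - 1)).1)
            have := hV1 ((σ (l' + 1)).1 - (σ l').1)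
            rw [hc₂]; linarith
        · rw [if_neg hl', hσ'ne l' hl']; simp
    · rw [if_neg hll, if_neg hll, sub_zero]
      have h1 : 0 ≤ (if l = i then c₂ else 0) := by split_ifs <;> [exact hc₂0; exact le_rfl]
      have h2 : 0 ≤ (if l' = i then c₂ else 0) := by split_ifs <;> [exact hc₂0; exact le_rfl]
      linarith
  -- summing up
  set box := Finset.Icc (μ - k) (μ + k) with hbox
  have hcard : (box.card : ℝ) = 2 * k + 1 := by
    have : box.card = 2 * k + 1 := by rw [hbox, Int.card_Icc]; omega
    rw [this]; push_cast; ring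
  have hS : ∑ l ∈ box, ((σ' l).2 ^ 2 / 2 + P.U (σ' l).1 + 1) ≤
      ∑ l ∈ box, ((σ l).2 ^ 2 / 2 + P.U (σ l).1 + 1) + c₁ := by
    have h := Finset.sum_le_sum fun l (_ : l ∈ box) => hsite l
    rw [Finset.sum_sub_distrib, Finset.sum_ite_eq'] at h
    have : (if i ∈ box then c₁ else 0) ≤ c₁ := by split_ifs <;> [exact le_rfl; exact hc₁0]
    linarith
  have hB : ∑ l ∈ box, ∑ l' ∈ box, (if |l' - l| = 1 then P.V ((σ' l).1 - (σ' l').1) else 0) ≤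
      ∑ l ∈ box, ∑ l' ∈ box, (if |l' - l| = 1 then P.V ((σ l).1 - (σ l').1) else 0) +
        2 * c₂ * (2 * k + 1) := by
    have h := Finset.sum_le_sum fun l (_ : l ∈ box) =>
      Finset.sum_le_sum fun l' (_ : l' ∈ box) => hbond l l'
    have e1 : ∑ l ∈ box, ∑ l' ∈ box, ((if l = i then c₂ else 0) + (if l' = i then c₂ else 0)) =
        (box.card : ℝ) * (if i ∈ box then c₂ else 0) + (box.card : ℝ) * (if i ∈ box then c₂ else 0) := by
      simp only [Finset.sum_add_distrib, Finset.sum_const, nsmul_eq_mul, Finset.sum_ite_eq']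
      rw [← Finset.mul_sum, Finset.sum_ite_eq']
    simp only [Finset.sum_sub_distrib] at h
    rw [e1, hcard] at h
    have : (if i ∈ box then c₂ else 0) ≤ c₂ := by split_ifs <;> [exact le_rfl; exact hc₂0]
    nlinarith
  unfold bmLocalEnergy
  have hk0 : (0 : ℝ) ≤ 2 * k + 1 := by positivity
  nlinarith

/-- The growth set of a one-site modification: every normalised local energy of the modified
configuration is at most `Q(σ) + c`, and the modification stays in `𝒳₀`. [folklore] -/
theorem update_mem_bmGood {s₁ s₂ : ℕ} (hU : IsEvenPolyOfDegree P.U s₁)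
    (hV : IsEvenPolyOfDegree P.V s₂) {σ : ChainConfig}
    (hσ : σ ∈ P.bmGood) (i : ℤ) :
    ∃ c : ℝ, 0 ≤ c ∧ ∀ z : ℝ × ℝ, ‖z - σ i‖ ≤ 1 →
      Function.update σ i z ∈ P.bmGood ∧
        ∀ r ∈ P.bmGrowthSet (Function.update σ i z), r ≤ P.bmGrowth σ + c := by
  obtain ⟨c, hc0, hc⟩ := P.bmLocalEnergy_update_le hU hV σ i
  refine ⟨c, hc0, fun z hz => ?_⟩
  have hbd : ∀ r ∈ P.bmGrowthSet (Function.update σ i z), r ≤ P.bmGrowth σ + c := by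
    rintro r ⟨μ, k, hk, rfl⟩
    have hpos : (0 : ℝ) < 2 * (k : ℝ) + 1 := by positivity
    rw [div_le_iff₀ hpos]
    have h1 := hc z hz μ k
    have h2 : P.bmLocalEnergy μ k σ / (2 * (k : ℝ) + 1) ≤ P.bmGrowth σ :=
      P.lc_le_bmGrowth hσ ⟨μ, k, hk, rfl⟩
    rw [div_le_iff₀ hpos] at h2
    nlinarith
  exact ⟨⟨P.bmGrowth σ + c, fun r hr => hbd r hr⟩, hbd⟩


/-! ### Section D: two solutions — force differences and the integral inequality -/

/-- The arithmetic behind `lc_force_sub_le`. [folklore] -/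
theorem lcForce_alg {AU AV KU KV S S' dm d0 dp eU eVp eVm xq xq' xrp xrp' xrm xrm' : ℝ}
    (hAU : 0 ≤ AU) (hAV : 0 ≤ AV) (hKU : 0 ≤ KU) (hKV : 0 ≤ KV) (hS : 1 ≤ S) (hS' : 1 ≤ S')
    (hdm : 0 ≤ dm) (hd0 : 0 ≤ d0) (hdp : 0 ≤ dp)
    (hxq : xq ≤ KU * S) (hxq' : xq' ≤ KU * S') (hxrp : xrp ≤ KV * S) (hxrp' : xrp' ≤ KV * S')
    (hxrm : xrm ≤ KV * S) (hxrm' : xrm' ≤ KV * S')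
    (heU : eU ≤ AU * (1 + xq + xq') * d0) (heVp : eVp ≤ AV * (1 + xrp + xrp') * (dp + d0))
    (heVm : eVm ≤ AV * (1 + xrm + xrm') * (d0 + dm)) :
    eU + eVp + eVm ≤ (AU + 2 * AV + 1) * (1 + KU + KV) * (S + S') * (dm + d0 + dp) := by
  set M := (1 + KU + KV) * (S + S') with hM
  have hexp : M = (S + S') + KU * (S + S') + KV * (S + S') := by rw [hM]; ring
  have hKU0 : 0 ≤ KU * (S + S') := by nlinarith
  have hKV0 : 0 ≤ KV * (S + S') := by nlinarith
  have h1 : 1 + xq + xq' ≤ M := by rw [hexp]; nlinarith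
  have h2 : 1 + xrp + xrp' ≤ M := by rw [hexp]; nlinarith
  have h3 : 1 + xrm + xrm' ≤ M := by rw [hexp]; nlinarith
  have hM0 : 0 ≤ M := by rw [hexp]; nlinarith
  have e1 : eU ≤ AU * M * d0 := by
    refine heU.trans ?_
    rw [mul_assoc, mul_assoc]
    exact mul_le_mul_of_nonneg_left (mul_le_mul_of_nonneg_right h1 hd0) hAU
  have e2 : eVp ≤ AV * M * (dp + d0) := by
    refine heVp.trans ?_
    rw [mul_assoc, mul_assoc]
    exact mul_le_mul_of_nonneg_left (mul_le_mul_of_nonneg_right h2 (by positivity)) hAV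
  have e3 : eVm ≤ AV * M * (d0 + dm) := by
    refine heVm.trans ?_
    rw [mul_assoc, mul_assoc]
    exact mul_le_mul_of_nonneg_left (mul_le_mul_of_nonneg_right h3 (by positivity)) hAV
  have hprod1 := mul_nonneg hAU hdm; have hprod2 := mul_nonneg hAU hdp
  have hprod3 := mul_nonneg hAV hdm; have hprod4 := mul_nonneg hAV hdp
  have hprod5 := mul_nonneg hAV hd0
  have hin : AU * d0 + AV * (dp + d0) + AV * (d0 + dm) ≤ (AU + 2 * AV + 1) * (dm + d0 + dp) := by
    nlinarith
  calc eU + eVp + eVm ≤ AU * M * d0 + AV * M * (dp + d0) + AV * M * (d0 + dm) :=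
        add_le_add (add_le_add e1 e2) e3
    _ = M * (AU * d0 + AV * (dp + d0) + AV * (d0 + dm)) := by ring
    _ ≤ M * ((AU + 2 * AV + 1) * (dm + d0 + dp)) := mul_le_mul_of_nonneg_left hin hM0
    _ = (AU + 2 * AV + 1) * (1 + KU + KV) * (S + S') * (dm + d0 + dp) := by rw [hM]; ring

/-- **Lipschitz bound for the force.** `|F_k(σ') - F_k(σ)| ≤ C (S_k(σ) + S_k(σ')) (d_{k-1} + d_k + d_{k+1})`
with `S_k(σ) = p_k²/2 + U(q_k) + 1 + V(q_{k+1}-q_k) + V(q_k-q_{k-1})` and `d_l = ‖σ'_l - σ_l‖`.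
[cite: ButtaMarchioro2016, §4 eqs. (4.4), (4.6)] -/
theorem lc_force_sub_le {s₁ s₂ : ℕ} (hU : IsEvenPolyOfDegree P.U s₁)
    (hV : IsEvenPolyOfDegree P.V s₂) :
    ∃ C : ℝ, 0 < C ∧ ∀ (σ σ' : ChainConfig) (k : ℤ),
      |P.force σ' k - P.force σ k| ≤
        C * (((σ k).2 ^ 2 / 2 + P.U (σ k).1 + 1 + P.V ((σ (k + 1)).1 - (σ k).1) +
              P.V ((σ k).1 - (σ (k - 1)).1)) +
            ((σ' k).2 ^ 2 / 2 + P.U (σ' k).1 + 1 + P.V ((σ' (k + 1)).1 - (σ' k).1) +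
              P.V ((σ' k).1 - (σ' (k - 1)).1))) *
          (‖σ' (k - 1) - σ (k - 1)‖ + ‖σ' k - σ k‖ + ‖σ' (k + 1) - σ (k + 1)‖) := by
  obtain ⟨AU, hAU, hLU⟩ := hU.lipschitz_deriv
  obtain ⟨AV, hAV, hLV⟩ := hV.lipschitz_deriv
  obtain ⟨KU, hKU, hcoU⟩ := hU.pow_le
  obtain ⟨KV, hKV, hcoV⟩ := hV.pow_le
  have hU0 := hU.nonneg
  have hV0 := hV.nonneg
  refine ⟨(AU + 2 * AV + 1) * (1 + KU + KV), by positivity, fun σ σ' k => ?_⟩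
  have hUq := hU0 (σ k).1
  have hUq' := hU0 (σ' k).1
  have hVrp := hV0 ((σ (k + 1)).1 - (σ k).1)
  have hVrp' := hV0 ((σ' (k + 1)).1 - (σ' k).1)
  have hVrm := hV0 ((σ k).1 - (σ (k - 1)).1)
  have hVrm' := hV0 ((σ' k).1 - (σ' (k - 1)).1)
  have hp2 := sq_nonneg (σ k).2
  have hp2' := sq_nonneg (σ' k).2
  -- coordinate differences
  have hdq : |(σ' k).1 - (σ k).1| ≤ ‖σ' k - σ k‖ := lc_abs_fst_sub_le (σ' k) (σ k)
  have hdq1 : |(σ' (k + 1)).1 - (σ (k + 1)).1| ≤ ‖σ' (k + 1) - σ (k + 1)‖ := lc_abs_fst_sub_le _ _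
  have hdqm : |(σ' (k - 1)).1 - (σ (k - 1)).1| ≤ ‖σ' (k - 1) - σ (k - 1)‖ := lc_abs_fst_sub_le _ _
  have hdrp : |(σ' (k + 1)).1 - (σ' k).1 - ((σ (k + 1)).1 - (σ k).1)| ≤
      ‖σ' (k + 1) - σ (k + 1)‖ + ‖σ' k - σ k‖ := by
    have : (σ' (k + 1)).1 - (σ' k).1 - ((σ (k + 1)).1 - (σ k).1) =
        ((σ' (k + 1)).1 - (σ (k + 1)).1) - ((σ' k).1 - (σ k).1) := by ring
    rw [this]
    exact (abs_sub _ _).trans (add_le_add hdq1 hdq)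
  have hdrm : |(σ' k).1 - (σ' (k - 1)).1 - ((σ k).1 - (σ (k - 1)).1)| ≤
      ‖σ' k - σ k‖ + ‖σ' (k - 1) - σ (k - 1)‖ := by
    have : (σ' k).1 - (σ' (k - 1)).1 - ((σ k).1 - (σ (k - 1)).1) =
        ((σ' k).1 - (σ k).1) - ((σ' (k - 1)).1 - (σ (k - 1)).1) := by ring
    rw [this]
    exact (abs_sub _ _).trans (add_le_add hdq hdqm)
  -- the three Lipschitz estimates
  have e1 : |deriv P.U (σ' k).1 - deriv P.U (σ k).1| ≤
      AU * (1 + |(σ k).1| ^ (2 * s₁) + |(σ' k).1| ^ (2 * s₁)) * ‖σ' k - σ k‖ := by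
    refine (hLU _ _).trans (mul_le_mul_of_nonneg_left hdq ?_)
    positivity
  have e2 : |deriv P.V ((σ' (k + 1)).1 - (σ' k).1) - deriv P.V ((σ (k + 1)).1 - (σ k).1)| ≤
      AV * (1 + |(σ (k + 1)).1 - (σ k).1| ^ (2 * s₂) + |(σ' (k + 1)).1 - (σ' k).1| ^ (2 * s₂)) *
        (‖σ' (k + 1) - σ (k + 1)‖ + ‖σ' k - σ k‖) := by
    refine (hLV _ _).trans (mul_le_mul_of_nonneg_left hdrp ?_)
    positivity
  have e3 : |deriv P.V ((σ' k).1 - (σ' (k - 1)).1) - deriv P.V ((σ k).1 - (σ (k - 1)).1)| ≤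
      AV * (1 + |(σ k).1 - (σ (k - 1)).1| ^ (2 * s₂) + |(σ' k).1 - (σ' (k - 1)).1| ^ (2 * s₂)) *
        (‖σ' k - σ k‖ + ‖σ' (k - 1) - σ (k - 1)‖) := by
    refine (hLV _ _).trans (mul_le_mul_of_nonneg_left hdrm ?_)
    positivity
  -- the force difference
  have hF : P.force σ' k - P.force σ k =
      -(deriv P.U (σ' k).1 - deriv P.U (σ k).1) +
        (deriv P.V ((σ' (k + 1)).1 - (σ' k).1) - deriv P.V ((σ (k + 1)).1 - (σ k).1)) -
        (deriv P.V ((σ' k).1 - (σ' (k - 1)).1) - deriv P.V ((σ k).1 - (σ (k - 1)).1)) := by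
    simp only [force, interactionForce]
    ring
  rw [hF]
  refine (abs_sub _ _).trans ?_
  refine (add_le_add ((abs_add_le _ _).trans (add_le_add (abs_neg _).le le_rfl)) le_rfl).trans ?_
  -- sizes
  have hxq := hcoU (σ k).1
  have hxq' := hcoU (σ' k).1
  have hxrp := hcoV ((σ (k + 1)).1 - (σ k).1)
  have hxrp' := hcoV ((σ' (k + 1)).1 - (σ' k).1)
  have hxrm := hcoV ((σ k).1 - (σ (k - 1)).1)
  have hxrm' := hcoV ((σ' k).1 - (σ' (k - 1)).1)
  refine lcForce_alg hAU hAV hKU.le hKV.le ?_ ?_ (norm_nonneg _) (norm_nonneg _)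
    (norm_nonneg _) (hxq.trans ?_) (hxq'.trans ?_) (hxrp.trans ?_) (hxrp'.trans ?_)
    (hxrm.trans ?_) (hxrm'.trans ?_) e1 e2 e3
  · linarith
  · linarith
  all_goals
    first
    | exact mul_le_mul_of_nonneg_left (by linarith) hKU.le
    | exact mul_le_mul_of_nonneg_left (by linarith) hKV.le

/-- **A priori size of one oscillator.** `‖σ_k‖ ≤ C₁ S_k(σ)`. [cite: ButtaMarchioro2016, §4 eq. (4.6)] -/
theorem lc_norm_site_le {s₁ : ℕ} (hU : IsEvenPolyOfDegree P.U s₁) (hs₁ : 1 ≤ s₁)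
    (hV0 : ∀ x, 0 ≤ P.V x) :
    ∃ C₁ : ℝ, 0 < C₁ ∧ ∀ (σ : ChainConfig) (k : ℤ),
      ‖σ k‖ ≤ C₁ * ((σ k).2 ^ 2 / 2 + P.U (σ k).1 + 1 + P.V ((σ (k + 1)).1 - (σ k).1) +
        P.V ((σ k).1 - (σ (k - 1)).1)) := by
  obtain ⟨KU, hKU, hcoU⟩ := hU.pow_le
  have hU0 := hU.nonneg
  refine ⟨1 + KU, by positivity, fun σ k => ?_⟩
  set S := (σ k).2 ^ 2 / 2 + P.U (σ k).1 + 1 + P.V ((σ (k + 1)).1 - (σ k).1) +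
    P.V ((σ k).1 - (σ (k - 1)).1) with hS
  have hUq := hU0 (σ k).1
  have hV1 := hV0 ((σ (k + 1)).1 - (σ k).1)
  have hV2 := hV0 ((σ k).1 - (σ (k - 1)).1)
  have hS1 : 1 ≤ S := by rw [hS]; nlinarith [sq_nonneg (σ k).2]
  have hp : |(σ k).2| ≤ S := by
    rw [hS]; nlinarith [sq_nonneg (|(σ k).2| - 1), sq_abs (σ k).2, abs_nonneg (σ k).2]
  have hq : |(σ k).1| ≤ (1 + KU) * S := by
    have h1 : |(σ k).1| ≤ 1 + |(σ k).1| ^ (2 * s₁) := by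
      have := abs_pow_le_one_add_abs_pow (σ k).1 (show 1 ≤ 2 * s₁ by omega)
      rwa [pow_one] at this
    have h2 := hcoU (σ k).1
    have h3 : 1 + P.U (σ k).1 ≤ S := by rw [hS]; nlinarith [sq_nonneg (σ k).2]
    nlinarith
  rw [Prod.norm_def, Real.norm_eq_abs, Real.norm_eq_abs]
  refine max_le (hq.trans le_rfl) (hp.trans ?_)
  nlinarith

/-- **Proximity transfers sizes.** If `σ'` is within distance `1` of `σ` at the sites
`k-1, k, k+1`, then `S_k(σ') ≤ C₂ S_k(σ)`. [folklore] -/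
theorem lc_site_perturb_le {s₁ s₂ : ℕ} (hU : IsEvenPolyOfDegree P.U s₁)
    (hV : IsEvenPolyOfDegree P.V s₂) :
    ∃ C₂ : ℝ, 0 < C₂ ∧ ∀ (σ σ' : ChainConfig) (k : ℤ),
      ‖σ' (k - 1) - σ (k - 1)‖ ≤ 1 → ‖σ' k - σ k‖ ≤ 1 → ‖σ' (k + 1) - σ (k + 1)‖ ≤ 1 →
      ((σ' k).2 ^ 2 / 2 + P.U (σ' k).1 + 1 + P.V ((σ' (k + 1)).1 - (σ' k).1) +
          P.V ((σ' k).1 - (σ' (k - 1)).1)) ≤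
        C₂ * ((σ k).2 ^ 2 / 2 + P.U (σ k).1 + 1 + P.V ((σ (k + 1)).1 - (σ k).1) +
          P.V ((σ k).1 - (σ (k - 1)).1)) := by
  obtain ⟨KU, hKU, hKUb⟩ := hU.perturb_le
  obtain ⟨KV, hKV, hKVb⟩ := hV.perturb_le
  have hU0 := hU.nonneg
  have hV0 := hV.nonneg
  refine ⟨4 + KU + 2 * KV, by positivity, fun σ σ' k hm h0 hp => ?_⟩
  set S := (σ k).2 ^ 2 / 2 + P.U (σ k).1 + 1 + P.V ((σ (k + 1)).1 - (σ k).1) +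
    P.V ((σ k).1 - (σ (k - 1)).1) with hS
  have hUq := hU0 (σ k).1
  have hV1 := hV0 ((σ (k + 1)).1 - (σ k).1)
  have hV2 := hV0 ((σ k).1 - (σ (k - 1)).1)
  have hS1 : 1 ≤ S := by rw [hS]; nlinarith [sq_nonneg (σ k).2]
  -- momentum
  have hdp : |(σ' k).2 - (σ k).2| ≤ 1 := (lc_abs_snd_sub_le _ _).trans h0
  have h1 : (σ' k).2 ^ 2 / 2 ≤ (σ k).2 ^ 2 + 1 := by
    have hle : |(σ' k).2| ≤ |(σ k).2| + 1 := by
      have := abs_sub_abs_le_abs_sub (σ' k).2 (σ k).2; linarith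
    have hsq : |(σ' k).2| ^ 2 ≤ (|(σ k).2| + 1) ^ 2 := pow_le_pow_left₀ (abs_nonneg _) hle 2
    rw [sq_abs] at hsq
    nlinarith [sq_abs (σ k).2, abs_nonneg (σ k).2, sq_nonneg (|(σ k).2| - 1)]
  -- pinning
  have hdq : |(σ' k).1 - (σ k).1| ≤ 1 := (lc_abs_fst_sub_le _ _).trans h0
  have h2 : P.U (σ' k).1 ≤ KU * (1 + P.U (σ k).1) := hKUb _ _ (hdq.trans (by norm_num))
  -- bonds
  have hdq1 : |(σ' (k + 1)).1 - (σ (k + 1)).1| ≤ 1 := (lc_abs_fst_sub_le _ _).trans hp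
  have hdqm : |(σ' (k - 1)).1 - (σ (k - 1)).1| ≤ 1 := (lc_abs_fst_sub_le _ _).trans hm
  have h3 : P.V ((σ' (k + 1)).1 - (σ' k).1) ≤ KV * (1 + P.V ((σ (k + 1)).1 - (σ k).1)) := by
    refine hKVb _ _ ?_
    have : (σ' (k + 1)).1 - (σ' k).1 - ((σ (k + 1)).1 - (σ k).1) =
        ((σ' (k + 1)).1 - (σ (k + 1)).1) - ((σ' k).1 - (σ k).1) := by ring
    rw [this]
    have := abs_sub ((σ' (k + 1)).1 - (σ (k + 1)).1) ((σ' k).1 - (σ k).1)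
    linarith
  have h4 : P.V ((σ' k).1 - (σ' (k - 1)).1) ≤ KV * (1 + P.V ((σ k).1 - (σ (k - 1)).1)) := by
    refine hKVb _ _ ?_
    have : (σ' k).1 - (σ' (k - 1)).1 - ((σ k).1 - (σ (k - 1)).1) =
        ((σ' k).1 - (σ k).1) - ((σ' (k - 1)).1 - (σ (k - 1)).1) := by ring
    rw [this]
    have := abs_sub ((σ' k).1 - (σ k).1) ((σ' (k - 1)).1 - (σ (k - 1)).1)
    linarith
  rw [hS]
  nlinarith

/-- Coordinates of a solution are continuous in time. [folklore] -/
theorem IsSolution.lc_continuous_apply {X : ℝ → ChainConfig} (hX : P.IsSolution X) (k : ℤ) :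
    Continuous fun s => X s k := by
  have h1 : Continuous fun s => (X s k).1 :=
    continuous_iff_continuousAt.2 fun s => (hX k s).1.continuousAt
  have h2 : Continuous fun s => (X s k).2 :=
    continuous_iff_continuousAt.2 fun s => (hX k s).2.continuousAt
  exact h1.prodMk h2

/-- The force along a solution is continuous in time (for `C¹` potentials). [folklore] -/
theorem IsSolution.lc_continuous_force {X : ℝ → ChainConfig} (hX : P.IsSolution X)
    (hUc : Continuous (deriv P.U)) (hVc : Continuous (deriv P.V)) (k : ℤ) :
    Continuous fun s => P.force (X s) k := by
  have hc : ∀ l : ℤ, Continuous fun s => (X s l).1 := fun l =>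
    continuous_fst.comp (hX.lc_continuous_apply P l)
  simp only [force, interactionForce]
  exact ((hUc.comp (hc k)).neg).add
    ((hVc.comp ((hc (k + 1)).sub (hc k))).sub (hVc.comp ((hc k).sub (hc (k - 1)))))

/-- **The integral inequality for the difference of two solutions.** If on `[0,t]` the force
difference at site `k` is bounded by `A (d_{k-1} + d_k + d_{k+1})` with `A ≥ 1`, then
`d_k(τ) ≤ d_k(0) + A ∫₀^τ (d_{k-1} + d_k + d_{k+1})` for `τ ∈ [0,t]`.
[cite: ButtaMarchioro2016, §4 eq. (4.3)] -/
theorem IsSolution.lc_norm_sub_le_integral {X X' : ℝ → ChainConfig} (hX : P.IsSolution X)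
    (hX' : P.IsSolution X') (hUc : Continuous (deriv P.U)) (hVc : Continuous (deriv P.V))
    {t : ℝ} (k : ℤ) {A : ℝ} (hA1 : 1 ≤ A)
    (hF : ∀ s ∈ Icc 0 t, |P.force (X' s) k - P.force (X s) k| ≤
      A * (‖X' s (k - 1) - X s (k - 1)‖ + ‖X' s k - X s k‖ + ‖X' s (k + 1) - X s (k + 1)‖))
    {τ : ℝ} (hτ : τ ∈ Icc 0 t) :
    ‖X' τ k - X τ k‖ ≤ ‖X' 0 k - X 0 k‖ +
      A * ∫ s in (0:ℝ)..τ, (‖X' s (k - 1) - X s (k - 1)‖ + ‖X' s k - X s k‖ +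
        ‖X' s (k + 1) - X s (k + 1)‖) := by
  obtain ⟨hτ0, hτt⟩ := hτ
  set w : ℝ → ℝ := fun s => ‖X' s (k - 1) - X s (k - 1)‖ + ‖X' s k - X s k‖ +
    ‖X' s (k + 1) - X s (k + 1)‖ with hw
  have hcd : ∀ l : ℤ, Continuous fun s => ‖X' s l - X s l‖ := fun l =>
    ((hX'.lc_continuous_apply P l).sub (hX.lc_continuous_apply P l)).norm
  have hwc : Continuous w := ((hcd _).add (hcd _)).add (hcd _)
  have hw0 : ∀ s, 0 ≤ w s := fun s => by positivity
  have hwi : IntervalIntegrable w volume 0 τ := hwc.intervalIntegrable _ _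
  have hIw0 : 0 ≤ ∫ s in (0:ℝ)..τ, w s := intervalIntegral.integral_nonneg hτ0 fun s _ => hw0 s
  -- positions
  have hq : |(X' τ k).1 - (X τ k).1| ≤ |(X' 0 k).1 - (X 0 k).1| + A * ∫ s in (0:ℝ)..τ, w s := by
    have hderiv : ∀ s ∈ uIcc 0 τ, HasDerivAt (fun s => (X' s k).1 - (X s k).1)
        ((X' s k).2 - (X s k).2) s := fun s _ => (hX' k s).1.sub (hX k s).1
    have hcont : Continuous fun s => (X' s k).2 - (X s k).2 :=
      (continuous_snd.comp (hX'.lc_continuous_apply P k)).sub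
        (continuous_snd.comp (hX.lc_continuous_apply P k))
    have hftc := intervalIntegral.integral_eq_sub_of_hasDerivAt hderiv
      (hcont.intervalIntegrable _ _)
    have hbd : |∫ s in (0:ℝ)..τ, ((X' s k).2 - (X s k).2)| ≤ ∫ s in (0:ℝ)..τ, w s := by
      refine (intervalIntegral.abs_integral_le_integral_abs hτ0).trans ?_
      refine intervalIntegral.integral_mono_on hτ0 (hcont.abs.intervalIntegrable _ _) hwi ?_
      intro s _
      have := lc_abs_snd_sub_le (X' s k) (X s k)
      have h1 : 0 ≤ ‖X' s (k - 1) - X s (k - 1)‖ := norm_nonneg _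
      have h2 : 0 ≤ ‖X' s (k + 1) - X s (k + 1)‖ := norm_nonneg _
      simp only [hw]; linarith
    have hA : ∫ s in (0:ℝ)..τ, w s ≤ A * ∫ s in (0:ℝ)..τ, w s :=
      le_mul_of_one_le_left hIw0 hA1
    have : (X' τ k).1 - (X τ k).1 = ((X' 0 k).1 - (X 0 k).1) +
        ∫ s in (0:ℝ)..τ, ((X' s k).2 - (X s k).2) := by rw [hftc]; ring
    rw [this]
    exact (abs_add_le _ _).trans (by linarith)
  -- momenta
  have hp : |(X' τ k).2 - (X τ k).2| ≤ |(X' 0 k).2 - (X 0 k).2| + A * ∫ s in (0:ℝ)..τ, w s := by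
    have hderiv : ∀ s ∈ uIcc 0 τ, HasDerivAt (fun s => (X' s k).2 - (X s k).2)
        (P.force (X' s) k - P.force (X s) k) s := fun s _ => (hX' k s).2.sub (hX k s).2
    have hcont : Continuous fun s => P.force (X' s) k - P.force (X s) k :=
      (hX'.lc_continuous_force P hUc hVc k).sub (hX.lc_continuous_force P hUc hVc k)
    have hftc := intervalIntegral.integral_eq_sub_of_hasDerivAt hderiv
      (hcont.intervalIntegrable _ _)
    have hbd : |∫ s in (0:ℝ)..τ, (P.force (X' s) k - P.force (X s) k)| ≤
        ∫ s in (0:ℝ)..τ, A * w s := by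
      refine (intervalIntegral.abs_integral_le_integral_abs hτ0).trans ?_
      refine intervalIntegral.integral_mono_on hτ0 (hcont.abs.intervalIntegrable _ _)
        (hwi.const_mul A) ?_
      intro s hs
      exact hF s ⟨hs.1, hs.2.trans hτt⟩
    rw [intervalIntegral.integral_const_mul] at hbd
    have : (X' τ k).2 - (X τ k).2 = ((X' 0 k).2 - (X 0 k).2) +
        ∫ s in (0:ℝ)..τ, (P.force (X' s) k - P.force (X s) k) := by rw [hftc]; ring
    rw [this]
    exact (abs_add_le _ _).trans (by linarith)
  -- combine
  have e0 : ‖X' 0 k - X 0 k‖ = max |(X' 0 k).1 - (X 0 k).1| |(X' 0 k).2 - (X 0 k).2| := by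
    rw [Prod.norm_def, Real.norm_eq_abs, Real.norm_eq_abs, Prod.fst_sub, Prod.snd_sub]
  rw [Prod.norm_def, Real.norm_eq_abs, Real.norm_eq_abs, Prod.fst_sub, Prod.snd_sub, e0]
  refine max_le ?_ ?_
  · exact hq.trans (add_le_add (le_max_left _ _) le_rfl)
  · exact hp.trans (add_le_add (le_max_right _ _) le_rfl)


/-! ### Section E: the one-site perturbation estimate for the BM flow -/

/-- **One-site perturbation estimate (two-pass Lipschitz iteration).** There is a constant
`C ≥ 1` depending only on the chain such that for any flow `Φ` on `𝒳₀` solving the equations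
(with `Φ₀ = id` and bounded growth of `Q` on bounded time intervals), any `x ∈ 𝒳₀`, `t > 0` and
`Q̄ ≥ sup_{s ≤ t} Q(Φ_s x)`, and any sites `i ≠ j` in the regime
`2e · 3 (C log(e+|i|) Q̄) (1 + log(e + 2|j-i|)) t ≤ |j-i|`, all sufficiently small modifications
`z` of `x_i` satisfy `‖Φ_t(x^z)_j - Φ_t(x)_j‖ ≤ 2 ‖z - x_i‖ 2^{-|j-i|}`. This is the rigorous
(difference-quotient) form of BM's bound (4.9) on the Jacobian `Δ_{j,i}(t,x)`.
[cite: ButtaMarchioro2016, §4 eqs. (4.3)–(4.9)] -/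
theorem perturbation_bound {s₁ s₂ : ℕ} (hU : IsEvenPolyOfDegree P.U s₁)
    (hV : IsEvenPolyOfDegree P.V s₂) (hs₁ : 1 ≤ s₁) :
    ∃ C : ℝ, 1 ≤ C ∧ ∀ (Φ : ℝ → ChainConfig → ChainConfig),
      (∀ t : ℝ, MapsTo (Φ t) P.bmGood P.bmGood) →
      (∀ σ ∈ P.bmGood, Φ 0 σ = σ) →
      (∀ σ ∈ P.bmGood, P.IsSolution fun t => Φ t σ) →
      (∀ t : ℝ, 0 < t → ∀ M : ℝ, ∃ M' : ℝ, ∀ σ ∈ P.bmGood, P.bmGrowth σ ≤ M →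
          ∀ s ∈ Icc 0 t, P.bmGrowth (Φ s σ) ≤ M') →
      ∀ x ∈ P.bmGood, ∀ (t : ℝ), 0 < t → ∀ (Qb : ℝ), 1 ≤ Qb →
        (∀ s ∈ Icc 0 t, P.bmGrowth (Φ s x) ≤ Qb) →
      ∀ (i j : ℤ), 1 ≤ (j - i).natAbs →
        2 * Real.exp 1 * (3 * (C * Real.log (Real.exp 1 + |(i : ℝ)|) * Qb) *
          (1 + Real.log (Real.exp 1 + (2 * (j - i).natAbs : ℕ))) * t) ≤ (j - i).natAbs →
      ∃ ε₁ : ℝ, 0 < ε₁ ∧ ∀ z : ℝ × ℝ, ‖z - x i‖ ≤ ε₁ →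
        ‖Φ t (Function.update x i z) j - Φ t x j‖ ≤ 2 * ‖z - x i‖ * (1 / 2) ^ (j - i).natAbs := by
  obtain ⟨CF, hCF, hF⟩ := P.lc_force_sub_le hU hV
  obtain ⟨C₁, hC₁, hN⟩ := P.lc_norm_site_le hU hs₁ hV.nonneg
  obtain ⟨C₂, hC₂, hPx⟩ := P.lc_site_perturb_le hU hV
  have hU0 := hU.nonneg
  have hV0 := hV.nonneg
  have hUc := hU.continuous_deriv
  have hVc := hV.continuous_deriv
  refine ⟨5 * CF * (1 + C₂) + 1, by nlinarith, ?_⟩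
  intro Φ hmaps h0 hsol hgrow x hx t ht Qb hQb hQ i j hD hreg
  -- the weight `g` and its properties
  set g : ℕ → ℝ := fun n => 1 + Real.log (Real.exp 1 + n) with hg
  have hg1 : ∀ n, 1 ≤ g n := BMLightCone.g_one_le
  have hgm : Monotone g := BMLightCone.g_monotone
  have hg3 : ∀ n : ℕ, g n ≤ 3 + n := BMLightCone.g_le
  have hg4 : ∀ m m' : ℕ, 1 ≤ m → m ≤ m' → (m : ℝ) * g (2 * m') ≤ m' * g (2 * m) :=
    fun m m' hm hmm' => BMLightCone.g_antitone hm hmm'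
  have hg0 : ∀ n, 0 ≤ g n := fun n => zero_le_one.trans (hg1 n)
  set Li : ℝ := Real.log (Real.exp 1 + |(i : ℝ)|) with hLi
  have hLi1 : 1 ≤ Li := lc_one_le_log_e_add i
  have hℓ : ∀ k : ℤ, Real.log (Real.exp 1 + |(k : ℝ)|) ≤ Li * g (k - i).natAbs := fun k =>
    BMLightCone.log_site_le i k
  -- one-site modifications of `x`
  obtain ⟨c, hc0, hc⟩ := P.update_mem_bmGood hU hV hx i
  obtain ⟨M', hM'⟩ := hgrow t ht (P.bmGrowth x + c)
  set Mb : ℝ := max M' 1 with hMb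
  have hMb1 : 1 ≤ Mb := le_max_right _ _
  -- crude constants
  set ac : ℝ := 5 * CF * Li * (Qb + Mb) + 1 with hac
  have hac1 : 1 ≤ ac := by
    have : 0 ≤ 5 * CF * Li * (Qb + Mb) := by positivity
    rw [hac]; linarith
  set B : ℝ := C₁ * 5 * Li * (Qb + Mb) with hB
  have hB0 : 0 ≤ B := by positivity
  obtain ⟨M₀, hM₀⟩ := BMLightCone.exists_threshold (2 * Real.exp 1 * (3 * ac * t))
  set K₁ : ℝ := Real.exp (3 * ac * g (2 * M₀) * t) + 2 with hK₁
  have hK₁0 : 0 < K₁ := by positivity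
  refine ⟨min 1 (1 / K₁), lt_min zero_lt_one (by positivity), fun z hz => ?_⟩
  have hz1 : ‖z - x i‖ ≤ 1 := hz.trans (min_le_left _ _)
  have hzK : ‖z - x i‖ * K₁ ≤ 1 := by
    have := hz.trans (min_le_right _ _)
    rwa [le_div_iff₀ hK₁0] at this
  set ε : ℝ := ‖z - x i‖ with hε
  have hε0 : 0 ≤ ε := norm_nonneg _
  set x' := Function.update x i z with hx'def
  obtain ⟨hx', hSx'⟩ := hc z hz1
  have hQx' : P.bmGrowth x' ≤ P.bmGrowth x + c := P.lc_bmGrowth_le hSx'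
  -- the two trajectories
  set X : ℝ → ChainConfig := fun s => Φ s x with hXdef
  set X' : ℝ → ChainConfig := fun s => Φ s x' with hX'def
  have hX : P.IsSolution X := hsol x hx
  have hX' : P.IsSolution X' := hsol x' hx'
  have hQX : ∀ s ∈ Icc 0 t, ∀ r ∈ P.bmGrowthSet (X s), r ≤ Qb := fun s hs r hr =>
    (P.lc_le_bmGrowth (hmaps s hx) hr).trans (hQ s hs)
  have hQX' : ∀ s ∈ Icc 0 t, ∀ r ∈ P.bmGrowthSet (X' s), r ≤ Mb := fun s hs r hr =>
    ((P.lc_le_bmGrowth (hmaps s hx') hr).trans (hM' x' hx' hQx' s hs)).trans (le_max_left _ _)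
  -- sizes along the trajectories
  have hSX : ∀ s ∈ Icc 0 t, ∀ k : ℤ,
      (X s k).2 ^ 2 / 2 + P.U (X s k).1 + 1 + P.V ((X s (k + 1)).1 - (X s k).1) +
        P.V ((X s k).1 - (X s (k - 1)).1) ≤ 5 * Li * Qb * g (k - i).natAbs := by
    intro s hs k
    refine (P.lc_site_le hU0 hV0 (hQX s hs) k).trans ?_
    have := hℓ k
    have hQb0 : 0 ≤ Qb := zero_le_one.trans hQb
    calc 5 * Real.log (Real.exp 1 + |(k : ℝ)|) * Qb ≤ 5 * (Li * g (k - i).natAbs) * Qb := by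
          gcongr
      _ = 5 * Li * Qb * g (k - i).natAbs := by ring
  have hSX' : ∀ s ∈ Icc 0 t, ∀ k : ℤ,
      (X' s k).2 ^ 2 / 2 + P.U (X' s k).1 + 1 + P.V ((X' s (k + 1)).1 - (X' s k).1) +
        P.V ((X' s k).1 - (X' s (k - 1)).1) ≤ 5 * Li * Mb * g (k - i).natAbs := by
    intro s hs k
    refine (P.lc_site_le hU0 hV0 (hQX' s hs) k).trans ?_
    have := hℓ k
    have hMb0 : 0 ≤ Mb := zero_le_one.trans hMb1
    calc 5 * Real.log (Real.exp 1 + |(k : ℝ)|) * Mb ≤ 5 * (Li * g (k - i).natAbs) * Mb := by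
          gcongr
      _ = 5 * Li * Mb * g (k - i).natAbs := by ring
  -- the difference function
  set u : ℤ → ℝ → ℝ := fun k s => ‖X' s k - X s k‖ with hudef
  have hu_cont : ∀ k, ContinuousOn (u k) (Icc 0 t) := fun k =>
    (((hX'.lc_continuous_apply P k).sub (hX.lc_continuous_apply P k)).norm).continuousOn
  have hu_nn : ∀ k s, 0 ≤ u k s := fun k s => norm_nonneg _
  have hu_bd : ∀ k, ∀ s ∈ Icc 0 t, u k s ≤ B * g (k - i).natAbs := by
    intro k s hs
    have h1 := hN (X s) k
    have h2 := hN (X' s) k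
    have h3 := hSX s hs k
    have h4 := hSX' s hs k
    calc u k s = ‖X' s k - X s k‖ := rfl
      _ ≤ ‖X' s k‖ + ‖X s k‖ := norm_sub_le _ _
      _ ≤ C₁ * (5 * Li * Mb * g (k - i).natAbs) + C₁ * (5 * Li * Qb * g (k - i).natAbs) :=
          add_le_add (h2.trans (mul_le_mul_of_nonneg_left h4 hC₁.le))
            (h1.trans (mul_le_mul_of_nonneg_left h3 hC₁.le))
      _ = B * g (k - i).natAbs := by rw [hB]; ring
  have hX0 : X 0 = x := h0 x hx
  have hX'0 : X' 0 = x' := h0 x' hx'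
  have hu_i : u i 0 ≤ ε := by
    show ‖X' 0 i - X 0 i‖ ≤ ε
    rw [hX0, hX'0, hx'def, Function.update_self]
  have hu_0 : ∀ k, k ≠ i → u k 0 ≤ 0 := by
    intro k hk
    show ‖X' 0 k - X 0 k‖ ≤ 0
    rw [hX0, hX'0, hx'def, Function.update_of_ne hk, sub_self, norm_zero]
  -- PASS 1: crude rates
  have hu_int : ∀ k, ∀ τ ∈ Icc 0 t, u k τ ≤ u k 0 +
      ac * g (k - i).natAbs * ∫ s in (0:ℝ)..τ, (u (k - 1) s + u k s + u (k + 1) s) := by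
    intro k τ hτ
    have hA1 : 1 ≤ ac * g (k - i).natAbs := by nlinarith [hg1 (k - i).natAbs]
    refine hX.lc_norm_sub_le_integral P hX' hUc hVc k hA1 (fun s hs => ?_) hτ
    refine (hF (X s) (X' s) k).trans ?_
    have h3 := hSX s hs k
    have h4 := hSX' s hs k
    have hd : 0 ≤ ‖X' s (k - 1) - X s (k - 1)‖ + ‖X' s k - X s k‖ + ‖X' s (k + 1) - X s (k + 1)‖ := by
      positivity
    refine mul_le_mul_of_nonneg_right ?_ hd
    calc CF * ((X s k).2 ^ 2 / 2 + P.U (X s k).1 + 1 + P.V ((X s (k + 1)).1 - (X s k).1) +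
            P.V ((X s k).1 - (X s (k - 1)).1) +
          ((X' s k).2 ^ 2 / 2 + P.U (X' s k).1 + 1 + P.V ((X' s (k + 1)).1 - (X' s k).1) +
            P.V ((X' s k).1 - (X' s (k - 1)).1)))
        ≤ CF * (5 * Li * Qb * g (k - i).natAbs + 5 * Li * Mb * g (k - i).natAbs) :=
          mul_le_mul_of_nonneg_left (add_le_add h3 h4) hCF.le
      _ = (5 * CF * Li * (Qb + Mb)) * g (k - i).natAbs := by ring
      _ ≤ ac * g (k - i).natAbs := by
          apply mul_le_mul_of_nonneg_right _ (hg0 _)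
          rw [hac]; linarith
  have hM₀' : ∀ m : ℕ, M₀ ≤ m → 2 * Real.exp 1 * (3 * ac * g (2 * m) * t) ≤ m := by
    intro m hm
    have := hM₀ m hm
    calc 2 * Real.exp 1 * (3 * ac * g (2 * m) * t)
        = 2 * Real.exp 1 * (3 * ac * t) * g (2 * m) := by ring
      _ ≤ m := this
  have hpass1 : ∀ k, ∀ s ∈ Icc 0 t, u k s ≤ 1 := by
    intro k s hs
    have := BMLightCone.lattice_iteration_uniform hg1 hgm hg3 hε0 (zero_le_one.trans hac1) hB0
      hu_cont hu_bd hu_i hu_0 hu_int hM₀' k hs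
    exact this.trans hzK
  -- PASS 2: sharp rates
  set as : ℝ := (5 * CF * (1 + C₂) + 1) * Li * Qb with has
  have has1 : 1 ≤ as := by
    rw [has]
    have h1 : (1 : ℝ) ≤ 5 * CF * (1 + C₂) + 1 := by nlinarith
    calc (1 : ℝ) = 1 * 1 * 1 := by ring
      _ ≤ (5 * CF * (1 + C₂) + 1) * Li * Qb := by gcongr
  have hu_int2 : ∀ k, ∀ τ ∈ Icc 0 t, u k τ ≤ u k 0 +
      as * g (k - i).natAbs * ∫ s in (0:ℝ)..τ, (u (k - 1) s + u k s + u (k + 1) s) := by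
    intro k τ hτ
    have hA1 : 1 ≤ as * g (k - i).natAbs := by nlinarith [hg1 (k - i).natAbs]
    refine hX.lc_norm_sub_le_integral P hX' hUc hVc k hA1 (fun s hs => ?_) hτ
    refine (hF (X s) (X' s) k).trans ?_
    have h3 := hSX s hs k
    have hprox := hPx (X s) (X' s) k (hpass1 (k - 1) s hs) (hpass1 k s hs) (hpass1 (k + 1) s hs)
    have hd : 0 ≤ ‖X' s (k - 1) - X s (k - 1)‖ + ‖X' s k - X s k‖ + ‖X' s (k + 1) - X s (k + 1)‖ := by
      positivity
    refine mul_le_mul_of_nonneg_right ?_ hd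
    have hS0 : 0 ≤ (X s k).2 ^ 2 / 2 + P.U (X s k).1 + 1 + P.V ((X s (k + 1)).1 - (X s k).1) +
        P.V ((X s k).1 - (X s (k - 1)).1) := by
      have := hU0 (X s k).1; have := hV0 ((X s (k + 1)).1 - (X s k).1)
      have := hV0 ((X s k).1 - (X s (k - 1)).1); positivity
    calc CF * ((X s k).2 ^ 2 / 2 + P.U (X s k).1 + 1 + P.V ((X s (k + 1)).1 - (X s k).1) +
            P.V ((X s k).1 - (X s (k - 1)).1) +
          ((X' s k).2 ^ 2 / 2 + P.U (X' s k).1 + 1 + P.V ((X' s (k + 1)).1 - (X' s k).1) +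
            P.V ((X' s k).1 - (X' s (k - 1)).1)))
        ≤ CF * ((1 + C₂) * ((X s k).2 ^ 2 / 2 + P.U (X s k).1 + 1 +
            P.V ((X s (k + 1)).1 - (X s k).1) + P.V ((X s k).1 - (X s (k - 1)).1))) := by
          refine mul_le_mul_of_nonneg_left ?_ hCF.le
          linarith
      _ ≤ CF * ((1 + C₂) * (5 * Li * Qb * g (k - i).natAbs)) := by gcongr
      _ = (5 * CF * (1 + C₂) * Li * Qb) * g (k - i).natAbs := by ring
      _ ≤ as * g (k - i).natAbs := by
          apply mul_le_mul_of_nonneg_right _ (hg0 _)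
          rw [has]; nlinarith
  have hreg' : 2 * Real.exp 1 * (3 * as * g (2 * (j - i).natAbs) * t) ≤ (j - i).natAbs := by
    simpa only [has, hg, hLi] using hreg
  have := BMLightCone.lattice_iteration_far hg1 hgm hg3 hg4 ht.le hε0 (zero_le_one.trans has1)
    hB0 hu_cont hu_bd hu_i hu_0 hu_int2 hD hreg'
  simpa only [hudef] using this


/-! ### Section G: consequences of the growth bound (2.7) and growth control on `[0,t]` -/

/-- From (2.7): bounded `Q` at time `0` gives uniformly bounded `Q` on `[0,t]`. [cite: ButtaMarchioro2016, §2 eq. (2.7)] -/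
theorem grow_of_bd (hU0 : ∀ x, 0 ≤ P.U x) (hV0 : ∀ x, 0 ≤ P.V x)
    {Φ : ℝ → ChainConfig → ChainConfig} (h0 : ∀ σ ∈ P.bmGood, Φ 0 σ = σ)
    {C a β c : ℝ} (ha : 0 ≤ a) (hβ : 0 ≤ β) (hc : 0 ≤ c)
    (hbd : ∀ t : ℝ, 0 < t → ∀ σ ∈ P.bmGood, P.bmGrowth (Φ t σ) ≤
      C * P.bmGrowth σ * (1 + t ^ a * (1 + t ^ β) * P.bmGrowth σ ^ c)) :
    ∀ t : ℝ, 0 < t → ∀ M : ℝ, ∃ M' : ℝ, ∀ σ ∈ P.bmGood, P.bmGrowth σ ≤ M →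
      ∀ s ∈ Icc 0 t, P.bmGrowth (Φ s σ) ≤ M' := by
  intro t ht M
  refine ⟨max M (|C| * M * (1 + t ^ a * (1 + t ^ β) * M ^ c)), fun σ hσ hσM s hs => ?_⟩
  have hQ1 : 1 ≤ P.bmGrowth σ := P.lc_one_le_bmGrowth hU0 hV0 hσ
  have hM1 : 1 ≤ M := hQ1.trans hσM
  rcases hs.1.eq_or_lt with hs0 | hs0
  · rw [← hs0, h0 σ hσ]
    exact hσM.trans (le_max_left _ _)
  · refine (hbd s hs0 σ hσ).trans (le_trans ?_ (le_max_right _ _))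
    have hQ0 : 0 ≤ P.bmGrowth σ := zero_le_one.trans hQ1
    have h1 : s ^ a ≤ t ^ a := Real.rpow_le_rpow hs.1 hs.2 ha
    have h2 : s ^ β ≤ t ^ β := Real.rpow_le_rpow hs.1 hs.2 hβ
    have h3 : P.bmGrowth σ ^ c ≤ M ^ c := Real.rpow_le_rpow hQ0 hσM hc
    have h4 : 0 ≤ s ^ a := Real.rpow_nonneg hs.1 _
    have h5 : 0 ≤ s ^ β := Real.rpow_nonneg hs.1 _
    have h6 : 0 ≤ P.bmGrowth σ ^ c := Real.rpow_nonneg hQ0 _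
    have h7 : 1 + s ^ a * (1 + s ^ β) * P.bmGrowth σ ^ c ≤ 1 + t ^ a * (1 + t ^ β) * M ^ c := by
      gcongr
    have h8 : 0 ≤ 1 + s ^ a * (1 + s ^ β) * P.bmGrowth σ ^ c := by positivity
    calc C * P.bmGrowth σ * (1 + s ^ a * (1 + s ^ β) * P.bmGrowth σ ^ c)
        ≤ |C| * P.bmGrowth σ * (1 + s ^ a * (1 + s ^ β) * P.bmGrowth σ ^ c) := by
          gcongr; exact le_abs_self C
      _ ≤ |C| * M * (1 + t ^ a * (1 + t ^ β) * M ^ c) := by gcongr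

/-- From (2.7) on `(0,1]`: `Q(Φ_s σ) ≤ 3|C| Q(σ)^{1+c}`. [cite: ButtaMarchioro2016, §4 (after eq. (4.7))] -/
theorem short_of_bd (hU0 : ∀ x, 0 ≤ P.U x) (hV0 : ∀ x, 0 ≤ P.V x)
    {Φ : ℝ → ChainConfig → ChainConfig}
    {C a β c : ℝ} (ha : 0 ≤ a) (hβ : 0 ≤ β) (hc : 0 ≤ c)
    (hbd : ∀ t : ℝ, 0 < t → ∀ σ ∈ P.bmGood, P.bmGrowth (Φ t σ) ≤
      C * P.bmGrowth σ * (1 + t ^ a * (1 + t ^ β) * P.bmGrowth σ ^ c)) :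
    ∀ σ ∈ P.bmGood, ∀ s : ℝ, 0 < s → s ≤ 1 →
      P.bmGrowth (Φ s σ) ≤ 3 * |C| * P.bmGrowth σ ^ (1 + c) := by
  intro σ hσ s hs0 hs1
  have hQ1 : 1 ≤ P.bmGrowth σ := P.lc_one_le_bmGrowth hU0 hV0 hσ
  have hQ0 : 0 < P.bmGrowth σ := zero_lt_one.trans_le hQ1
  set Q := P.bmGrowth σ with hQ
  refine (hbd s hs0 σ hσ).trans ?_
  have h1 : s ^ a ≤ 1 := Real.rpow_le_one hs0.le hs1 ha
  have h2 : s ^ β ≤ 1 := Real.rpow_le_one hs0.le hs1 hβ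
  have h4 : 0 ≤ s ^ a := Real.rpow_nonneg hs0.le _
  have h5 : 0 ≤ s ^ β := Real.rpow_nonneg hs0.le _
  have h6 : 0 ≤ Q ^ c := Real.rpow_nonneg hQ0.le _
  have h7 : s ^ a * (1 + s ^ β) * Q ^ c ≤ 1 * (1 + 1) * Q ^ c := by gcongr
  have hQc : Q * Q ^ c = Q ^ (1 + c) := by
    rw [Real.rpow_add hQ0, Real.rpow_one]
  have hQle : Q ≤ Q ^ (1 + c) := by
    calc Q = Q ^ (1 : ℝ) := (Real.rpow_one Q).symm
      _ ≤ Q ^ (1 + c) := Real.rpow_le_rpow_of_exponent_le hQ1 (by linarith)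
  have h8 : 0 ≤ 1 + s ^ a * (1 + s ^ β) * Q ^ c := by positivity
  calc C * Q * (1 + s ^ a * (1 + s ^ β) * Q ^ c)
      ≤ |C| * Q * (1 + s ^ a * (1 + s ^ β) * Q ^ c) :=
        mul_le_mul_of_nonneg_right (mul_le_mul_of_nonneg_right (le_abs_self C) hQ0.le) h8
    _ ≤ |C| * Q * (1 + 1 * (1 + 1) * Q ^ c) := by gcongr
    _ = |C| * (Q + 2 * (Q * Q ^ c)) := by ring
    _ ≤ |C| * (Q ^ (1 + c) + 2 * Q ^ (1 + c)) := by rw [hQc]; gcongr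
    _ = 3 * |C| * Q ^ (1 + c) := by ring

/-- **Growth control along good orbits** (BM §4, display before (4.8)): if `Q(Φ_k x) ≤ log^δ k`
for all large integers `k`, then `sup_{s ≤ t} Q(Φ_s x) ≤ M + C (log t)^{δ(1+c)}` for all large
`t`. [cite: ButtaMarchioro2016, §4 eq. (4.8)] -/
theorem growth_control {Φ : ℝ → ChainConfig → ChainConfig}
    (hmaps : ∀ t : ℝ, MapsTo (Φ t) P.bmGood P.bmGood)
    (hgrp : ∀ t s : ℝ, ∀ σ ∈ P.bmGood, Φ (t + s) σ = Φ t (Φ s σ))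
    (hU0 : ∀ x, 0 ≤ P.U x) (hV0 : ∀ x, 0 ≤ P.V x)
    {C c : ℝ} (hC : 0 ≤ C) (hc : 0 ≤ c)
    (hshort : ∀ σ ∈ P.bmGood, ∀ s : ℝ, 0 < s → s ≤ 1 →
      P.bmGrowth (Φ s σ) ≤ C * P.bmGrowth σ ^ (1 + c))
    (hgrow : ∀ t : ℝ, 0 < t → ∀ M : ℝ, ∃ M' : ℝ, ∀ σ ∈ P.bmGood, P.bmGrowth σ ≤ M →
      ∀ s ∈ Icc 0 t, P.bmGrowth (Φ s σ) ≤ M')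
    {x : ChainConfig} (hx : x ∈ P.bmGood) {δ : ℝ} (hδ : 0 < δ)
    (hBC : ∀ᶠ k : ℕ in atTop, P.bmGrowth (Φ k x) ≤ Real.log k ^ δ) :
    ∃ M T : ℝ, 0 ≤ M ∧ ∀ t : ℝ, T ≤ t →
      ∀ s ∈ Icc 0 t, P.bmGrowth (Φ s x) ≤ M + C * Real.log t ^ (δ * (1 + c)) := by
  obtain ⟨n₀, hn₀⟩ := eventually_atTop.1 hBC
  set n₁ : ℕ := max n₀ 1 with hn₁
  obtain ⟨M', hM'⟩ := hgrow ((n₁ : ℝ) + 1) (by positivity) (P.bmGrowth x)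
  refine ⟨max M' 0, (n₁ : ℝ) + 1, le_max_right _ _, fun t ht s hs => ?_⟩
  have hn₁1 : (1 : ℝ) ≤ n₁ := by exact_mod_cast le_max_right n₀ 1
  have ht1 : 1 < t := by linarith
  have hlogt : 0 ≤ Real.log t := Real.log_nonneg ht1.le
  have hpow0 : 0 ≤ C * Real.log t ^ (δ * (1 + c)) := mul_nonneg hC (Real.rpow_nonneg hlogt _)
  rcases le_or_gt s ((n₁ : ℝ) + 1) with hsn | hsn
  · have := hM' x hx le_rfl s ⟨hs.1, hsn⟩
    exact this.trans ((le_max_left _ _).trans (le_add_of_nonneg_right hpow0))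
  · -- `k := ⌈s⌉ - 1`, so that `k < s ≤ k + 1` and `k ≥ n₁`
    have hs0 : 0 ≤ s := hs.1
    set k : ℕ := ⌈s⌉₊ - 1 with hk
    have hceil1 : 1 ≤ ⌈s⌉₊ := Nat.one_le_iff_ne_zero.2 (by
      intro h; rw [Nat.ceil_eq_zero] at h; linarith)
    have hk1 : ((k : ℕ) : ℝ) + 1 = ⌈s⌉₊ := by
      rw [hk]; push_cast [Nat.cast_sub hceil1]; ring
    have hks : (k : ℝ) < s := by
      have := Nat.ceil_lt_add_one hs0; linarith
    have hsk : s ≤ (k : ℝ) + 1 := by rw [hk1]; exact Nat.le_ceil s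
    have hkn : n₁ ≤ k := by
      have h1 : (n₁ : ℝ) + 1 < ⌈s⌉₊ := lt_of_lt_of_le hsn (Nat.le_ceil s)
      have h2 : n₁ + 1 < ⌈s⌉₊ := by exact_mod_cast h1
      omega
    have hkn₀ : n₀ ≤ k := le_trans (le_max_left _ _) hkn
    have hk1' : 1 ≤ k := le_trans (le_max_right _ _) hkn
    have hkpos : (0 : ℝ) < k := by exact_mod_cast hk1'
    have hQk := hn₀ k hkn₀
    have hy : Φ k x ∈ P.bmGood := hmaps k hx
    set τ : ℝ := s - k with hτ
    have hτ0 : 0 < τ := by rw [hτ]; linarith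
    have hτ1 : τ ≤ 1 := by rw [hτ]; linarith
    have hsplit : Φ s x = Φ τ (Φ k x) := by
      rw [← hgrp τ k x hx]; congr 1; rw [hτ]; ring
    rw [hsplit]
    refine (hshort _ hy τ hτ0 hτ1).trans ?_
    have hlogk : 0 ≤ Real.log k := Real.log_nonneg (by exact_mod_cast hk1')
    have hlogkt : Real.log k ≤ Real.log t := Real.log_le_log hkpos (by linarith [hs.2])
    have hQ0 : 0 ≤ P.bmGrowth (Φ k x) := zero_le_one.trans (P.lc_one_le_bmGrowth hU0 hV0 hy)
    have h1 : P.bmGrowth (Φ k x) ^ (1 + c) ≤ (Real.log k ^ δ) ^ (1 + c) :=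
      Real.rpow_le_rpow hQ0 hQk (by linarith)
    have h2 : (Real.log k ^ δ) ^ (1 + c) = Real.log k ^ (δ * (1 + c)) := by
      rw [← Real.rpow_mul hlogk]
    have h3 : Real.log k ^ (δ * (1 + c)) ≤ Real.log t ^ (δ * (1 + c)) :=
      Real.rpow_le_rpow hlogk hlogkt (by positivity)
    calc C * P.bmGrowth (Φ (k : ℝ) x) ^ (1 + c) ≤ C * Real.log t ^ (δ * (1 + c)) := by
          refine mul_le_mul_of_nonneg_left ?_ hC
          rw [← h2] at h3; exact h1.trans h3
      _ ≤ max M' 0 + C * Real.log t ^ (δ * (1 + c)) := le_add_of_nonneg_left (le_max_right _ _)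

/-! ### Section E': from the perturbation estimate to the Poisson bracket -/

/-- **The bracket is controlled by the one-site perturbation constant.** If small modifications
`z` of `x_i` move `Φ_t(·)_j` by at most `K ‖z - x_i‖`, then
`|{f_i, Φ_t g_j}(x)| ≤ 2 ‖Df‖_∞ ‖Dg‖_∞ K` (the tree's `deriv`-based bracket; BM: "It is
straightforward to verify that `|{f_i,Φ_t g_j}(x)| ≤ C‖Df‖_∞‖Dg‖_∞‖Δ_{j,i}(t,x)‖`").
[cite: ButtaMarchioro2016, §4 (after eq. (4.2))] -/
theorem bracket_le {Φ : ℝ → ChainConfig → ChainConfig} {x : ChainConfig} {t : ℝ} {i j : ℤ}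
    {K : ℝ} (hK : 0 ≤ K) {ε₁ : ℝ} (hε₁ : 0 < ε₁)
    (hpert : ∀ z : ℝ × ℝ, ‖z - x i‖ ≤ ε₁ →
      ‖Φ t (Function.update x i z) j - Φ t x j‖ ≤ K * ‖z - x i‖)
    {f g : ℝ × ℝ → ℝ} (hf : Differentiable ℝ f) (hg : Differentiable ℝ g) {Mf Mg : ℝ}
    (hMf : ∀ z, ‖fderiv ℝ f z‖ ≤ Mf) (hMg : ∀ z, ‖fderiv ℝ g z‖ ≤ Mg) :
    |sitePoissonBracket i (siteObs f i) (siteObs g j ∘ Φ t) x| ≤ 2 * Mf * Mg * K := by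
  have hMf0 : 0 ≤ Mf := (norm_nonneg _).trans (hMf 0)
  have hMg0 : 0 ≤ Mg := (norm_nonneg _).trans (hMg 0)
  have hLf := BMLightCone.lipschitz_of_fderiv_le hf hMf
  have hLg := BMLightCone.lipschitz_of_fderiv_le hg hMg
  -- the four partial derivatives
  have h1 : |partialQZ i (siteObs f i) x| ≤ Mf := by
    unfold partialQZ
    have : (fun s : ℝ => siteObs f i (Function.update x i (s, (x i).2))) = fun s => f (s, (x i).2) := by
      funext s; simp [siteObs]
    rw [this]
    refine BMLightCone.abs_deriv_le_of_lip hMf0 (Eventually.of_forall fun s => ?_)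
    have := hLf ((x i).1, (x i).2) (s, (x i).2)
    have hn : ‖((s, (x i).2) : ℝ × ℝ) - ((x i).1, (x i).2)‖ = |s - (x i).1| := by
      simp [Prod.norm_def, Real.norm_eq_abs]
    rwa [hn] at this
  have h2 : |partialPZ i (siteObs f i) x| ≤ Mf := by
    unfold partialPZ
    have : (fun s : ℝ => siteObs f i (Function.update x i ((x i).1, s))) = fun s => f ((x i).1, s) := by
      funext s; simp [siteObs]
    rw [this]
    refine BMLightCone.abs_deriv_le_of_lip hMf0 (Eventually.of_forall fun s => ?_)
    have := hLf ((x i).1, (x i).2) ((x i).1, s)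
    have hn : ‖(((x i).1, s) : ℝ × ℝ) - ((x i).1, (x i).2)‖ = |s - (x i).2| := by
      simp [Prod.norm_def, Real.norm_eq_abs]
    rwa [hn] at this
  have hxi : ∀ z : ℝ × ℝ, z = x i → Function.update x i z = x := fun z hz => by
    rw [hz, Function.update_eq_self]
  have h3 : |partialPZ i (siteObs g j ∘ Φ t) x| ≤ Mg * K := by
    unfold partialPZ
    refine BMLightCone.abs_deriv_le_of_lip (by positivity) ?_
    filter_upwards [Metric.closedBall_mem_nhds (x i).2 hε₁] with s hs
    rw [Metric.mem_closedBall, Real.dist_eq] at hs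
    set z : ℝ × ℝ := ((x i).1, s) with hz
    have hzn : ‖z - x i‖ = |s - (x i).2| := by
      have : z - x i = (0, s - (x i).2) := by
        rw [hz]; ext <;> simp
      rw [this, Prod.norm_def]; simp [Real.norm_eq_abs]
    have hp := hpert z (by rw [hzn]; exact hs)
    have hx0 : Function.update x i ((x i).1, (x i).2) = x := hxi _ (Prod.mk.eta)
    simp only [Function.comp_apply, siteObs_apply, hx0]
    calc |g (Φ t (Function.update x i z) j) - g (Φ t x j)|
        ≤ Mg * ‖Φ t (Function.update x i z) j - Φ t x j‖ := hLg _ _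
      _ ≤ Mg * (K * ‖z - x i‖) := mul_le_mul_of_nonneg_left hp hMg0
      _ = Mg * K * |s - (x i).2| := by rw [hzn]; ring
  have h4 : |partialQZ i (siteObs g j ∘ Φ t) x| ≤ Mg * K := by
    unfold partialQZ
    refine BMLightCone.abs_deriv_le_of_lip (by positivity) ?_
    filter_upwards [Metric.closedBall_mem_nhds (x i).1 hε₁] with s hs
    rw [Metric.mem_closedBall, Real.dist_eq] at hs
    set z : ℝ × ℝ := (s, (x i).2) with hz
    have hzn : ‖z - x i‖ = |s - (x i).1| := by
      have : z - x i = (s - (x i).1, 0) := by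
        rw [hz]; ext <;> simp
      rw [this, Prod.norm_def]; simp [Real.norm_eq_abs]
    have hp := hpert z (by rw [hzn]; exact hs)
    have hx0 : Function.update x i ((x i).1, (x i).2) = x := hxi _ (Prod.mk.eta)
    simp only [Function.comp_apply, siteObs_apply, hx0]
    calc |g (Φ t (Function.update x i z) j) - g (Φ t x j)|
        ≤ Mg * ‖Φ t (Function.update x i z) j - Φ t x j‖ := hLg _ _
      _ ≤ Mg * (K * ‖z - x i‖) := mul_le_mul_of_nonneg_left hp hMg0
      _ = Mg * K * |s - (x i).1| := by rw [hzn]; ring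
  unfold sitePoissonBracket
  calc |partialQZ i (siteObs f i) x * partialPZ i (siteObs g j ∘ Φ t) x -
        partialPZ i (siteObs f i) x * partialQZ i (siteObs g j ∘ Φ t) x|
      ≤ |partialQZ i (siteObs f i) x * partialPZ i (siteObs g j ∘ Φ t) x| +
        |partialPZ i (siteObs f i) x * partialQZ i (siteObs g j ∘ Φ t) x| := abs_sub _ _
    _ = |partialQZ i (siteObs f i) x| * |partialPZ i (siteObs g j ∘ Φ t) x| +
        |partialPZ i (siteObs f i) x| * |partialQZ i (siteObs g j ∘ Φ t) x| := by
          rw [abs_mul, abs_mul]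
    _ ≤ Mf * (Mg * K) + Mf * (Mg * K) :=
        add_le_add (mul_le_mul h1 h3 (abs_nonneg _) hMf0) (mul_le_mul h2 h4 (abs_nonneg _) hMf0)
    _ = 2 * Mf * Mg * K := by ring

/-- Monotonicity in `D` of the regime condition: if `K ≤ D₀`, `K (1 + log(e + 2D₀)) ≤ D₀` and
`D₀ ≤ D`, then `K (1 + log(e + 2D)) ≤ D`. [folklore] -/
private theorem lc_regime_mono {K D₀ D : ℝ} (hK : 0 ≤ K) (hKD : K ≤ D₀)
    (h0 : K * (1 + Real.log (Real.exp 1 + 2 * D₀)) ≤ D₀) (hD : D₀ ≤ D) :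
    K * (1 + Real.log (Real.exp 1 + 2 * D)) ≤ D := by
  have hD₀ : 0 ≤ D₀ := hK.trans hKD
  set a : ℝ := Real.exp 1 + 2 * D₀ with ha
  set y : ℝ := Real.exp 1 + 2 * D with hy
  have ha0 : 0 < a := by rw [ha]; positivity
  have hay : a ≤ y := by rw [ha, hy]; linarith
  have hy0 : 0 < y := ha0.trans_le hay
  have hlog : Real.log y - Real.log a ≤ (y - a) / a := by
    have := Real.log_le_sub_one_of_pos (div_pos hy0 ha0)
    rw [Real.log_div hy0.ne' ha0.ne'] at this
    rw [div_sub_one ha0.ne'] at this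
    exact this
  have hya : y - a = 2 * (D - D₀) := by rw [ha, hy]; ring
  have h2K : 2 * K ≤ a := by rw [ha]; linarith [Real.exp_pos 1]
  have hkey : K * (Real.log y - Real.log a) ≤ D - D₀ := by
    have h1 : K * (Real.log y - Real.log a) ≤ K * ((y - a) / a) :=
      mul_le_mul_of_nonneg_left hlog hK
    have h2 : K * ((y - a) / a) ≤ D - D₀ := by
      rw [hya, mul_div_assoc', div_le_iff₀ ha0]
      nlinarith
    linarith
  nlinarith

/-- Choice of the auxiliary exponents `γ ∈ (η,2)` and `δ > 1` with `δ · 2/(2-γ) + 1 < α`, possible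
exactly because `α > (4-η)/(2-η)`. [cite: ButtaMarchioro2016, §4 eq. (4.1)] -/
theorem exists_gamma_delta {η α : ℝ} (hη0 : 0 ≤ η) (hη1 : η < 1)
    (hα : (4 - η) / (2 - η) < α) :
    ∃ γ δ : ℝ, η < γ ∧ γ < 2 ∧ 1 < δ ∧ δ * (1 + γ / (2 - γ)) + 1 < α := by
  have h2η : 0 < 2 - η := by linarith
  set A₀ : ℝ := 2 / (2 - η) with hA₀
  set A : ℝ := α - 1 with hA
  have hA₀1 : 1 ≤ A₀ := by rw [hA₀, le_div_iff₀ h2η]; linarith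
  have hA₀A : A₀ < A := by
    have : (4 - η) / (2 - η) = 1 + 2 / (2 - η) := by field_simp; ring
    rw [this] at hα; rw [hA₀, hA]; linarith
  have hA0 : 0 < A := lt_of_lt_of_le (lt_of_lt_of_le zero_lt_one hA₀1) hA₀A.le
  have hS : 0 < A₀ + A := by linarith
  set γ : ℝ := 2 - 4 / (A₀ + A) with hγ
  set δm : ℝ := 2 * A / (A₀ + A) with hδm
  have hδm1 : 1 < δm := by rw [hδm, lt_div_iff₀ hS]; linarith
  refine ⟨γ, (1 + δm) / 2, ?_, ?_, by linarith, ?_⟩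
  · -- `η < γ`
    rw [hγ]
    have h1 : 4 / (A₀ + A) < 2 - η := by
      rw [div_lt_iff₀ hS]
      have : (2 - η) * A₀ = 2 := by rw [hA₀]; field_simp
      nlinarith
    linarith
  · rw [hγ]; have : 0 < 4 / (A₀ + A) := by positivity
    linarith
  · -- `δ (A₀ + A)/2 + 1 < α`
    have h2γ : 2 - γ = 4 / (A₀ + A) := by rw [hγ]; ring
    have h1 : 1 + γ / (2 - γ) = (A₀ + A) / 2 := by
      have hne : (2 - γ) ≠ 0 := by rw [h2γ]; positivity
      have e1 : 1 + γ / (2 - γ) = 2 / (2 - γ) := by field_simp; ring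
      rw [e1, h2γ]
      field_simp
      norm_num
    rw [h1]
    have h3 : (1 + δm) / 2 * ((A₀ + A) / 2) < A := by
      have : δm * ((A₀ + A) / 2) = A := by rw [hδm]; field_simp
      nlinarith
    rw [hA] at h3
    linarith


/-! ### Section H: the light cone along one good orbit -/

/-- `(1/2)^D ≤ e^{-t(b+1)}` once `t (b+1) ≤ D log 2`. [folklore] -/
private theorem lc_half_pow_le_exp {D : ℕ} {t b : ℝ} (h : t * (b + 1) ≤ D * Real.log 2) :
    (1 / 2 : ℝ) ^ D ≤ Real.exp (-(t * (b + 1))) := by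
  have h2 : (1 / 2 : ℝ) ^ D = Real.exp (-(D * Real.log 2)) := by
    rw [Real.exp_neg, Real.exp_nat_mul, Real.exp_log two_pos, one_div_pow, inv_eq_one_div]
  rw [h2]
  exact Real.exp_le_exp.2 (by linarith)

/-- **The light cone along a good orbit.** For `x ∈ 𝒳₀` whose orbit obeys `Q(Φ_k x) ≤ log^δ k`
for all large integers `k`, and exponents with `δ(1+c) + 1 < α` (where `1 + c = 2/(2-γ)`), one has
for every `ε > 0`, eventually in `t`, for all `j` with `|i - j| > t log^α t`:
`e^{bt} |{f_i, Φ_t g_j}(x)| ≤ ε`. [cite: ButtaMarchioro2016, §4 eqs. (4.8)–(4.9)] -/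
theorem lightCone_at {s₁ s₂ : ℕ} (hU : IsEvenPolyOfDegree P.U s₁) (hV : IsEvenPolyOfDegree P.V s₂)
    (hs₁ : 1 ≤ s₁) {Φ : ℝ → ChainConfig → ChainConfig}
    (hmaps : ∀ t : ℝ, MapsTo (Φ t) P.bmGood P.bmGood)
    (h0 : ∀ σ ∈ P.bmGood, Φ 0 σ = σ)
    (hgrp : ∀ t s : ℝ, ∀ σ ∈ P.bmGood, Φ (t + s) σ = Φ t (Φ s σ))
    (hsol : ∀ σ ∈ P.bmGood, P.IsSolution fun t => Φ t σ)
    {C c : ℝ} (hC : 0 ≤ C) (hc : 0 ≤ c)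
    (hshort : ∀ σ ∈ P.bmGood, ∀ s : ℝ, 0 < s → s ≤ 1 →
      P.bmGrowth (Φ s σ) ≤ C * P.bmGrowth σ ^ (1 + c))
    (hgrow : ∀ t : ℝ, 0 < t → ∀ M : ℝ, ∃ M' : ℝ, ∀ σ ∈ P.bmGood, P.bmGrowth σ ≤ M →
      ∀ s ∈ Icc 0 t, P.bmGrowth (Φ s σ) ≤ M')
    {x : ChainConfig} (hx : x ∈ P.bmGood) {δ : ℝ} (hδ : 0 < δ)
    (hBC : ∀ᶠ k : ℕ in atTop, P.bmGrowth (Φ k x) ≤ Real.log k ^ δ)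
    {α : ℝ} (hα : δ * (1 + c) + 1 < α)
    {f g : ℝ × ℝ → ℝ} (hf : Differentiable ℝ f) (hg : Differentiable ℝ g) {Mf Mg : ℝ}
    (hMf : ∀ z, ‖fderiv ℝ f z‖ ≤ Mf) (hMg : ∀ z, ‖fderiv ℝ g z‖ ≤ Mg) (i : ℤ) (b : ℝ) :
    ∀ ε : ℝ, 0 < ε → ∀ᶠ t : ℝ in atTop, ∀ j : ℤ,
      t * Real.log t ^ α < |((i : ℝ) - (j : ℝ))| →
        Real.exp (b * t) * |sitePoissonBracket i (siteObs f i) (siteObs g j ∘ Φ t) x| ≤ ε := by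
  have hU0 := hU.nonneg
  have hV0 := hV.nonneg
  obtain ⟨Cp, hCp1, hpert⟩ := P.perturbation_bound hU hV hs₁
  obtain ⟨M, T, hM0, hMT⟩ := P.growth_control hmaps hgrp hU0 hV0 hC hc hshort hgrow hx hδ hBC
  set p : ℝ := δ * (1 + c) with hp
  have hp0 : 0 < p := by rw [hp]; positivity
  have hαp : 0 < α - p - 1 := by linarith
  have hα0 : 0 < α := by linarith
  set Li : ℝ := Real.log (Real.exp 1 + |(i : ℝ)|) with hLi
  have hLi1 : 1 ≤ Li := lc_one_le_log_e_add i
  have hMf0 : 0 ≤ Mf := (norm_nonneg _).trans (hMf 0)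
  have hMg0 : 0 ≤ Mg := (norm_nonneg _).trans (hMg 0)
  have hCp0 : 0 ≤ Cp := zero_le_one.trans hCp1
  set K₀ : ℝ := 24 * Real.exp 1 * Cp * Li * (M + C) with hK₀
  have hK₀0 : 0 ≤ K₀ := by positivity
  intro ε hε
  -- the eventual conditions on `t`
  have hlogT : Tendsto Real.log atTop atTop := Real.tendsto_log_atTop
  have E1 : ∀ᶠ t : ℝ in atTop, T ≤ t := eventually_ge_atTop T
  have E2 : ∀ᶠ t : ℝ in atTop, 3 ≤ t := eventually_ge_atTop 3
  have E3 : ∀ᶠ t : ℝ in atTop, ‖Real.log t ^ α‖ ≤ 1 * ‖t ^ (1 : ℝ)‖ :=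
    (isLittleO_log_rpow_rpow_atTop α zero_lt_one).def zero_lt_one
  have E4 : ∀ᶠ t : ℝ in atTop, K₀ ≤ Real.log t ^ (α - p - 1) :=
    ((tendsto_rpow_atTop hαp).comp hlogT).eventually_ge_atTop K₀
  have E5 : ∀ᶠ t : ℝ in atTop, (b + 1) / Real.log 2 ≤ Real.log t ^ α :=
    ((tendsto_rpow_atTop hα0).comp hlogT).eventually_ge_atTop _
  have E6 : ∀ᶠ t : ℝ in atTop, Real.exp (-t) < ε / (4 * Mf * Mg + 1) :=
    Real.tendsto_exp_neg_atTop_nhds_zero.eventually (gt_mem_nhds (by positivity))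
  filter_upwards [E1, E2, E3, E4, E5, E6] with t h1 h2 h3 h4 h5 h6
  intro j hj
  have ht0 : 0 < t := by linarith
  have hlog1 : 1 ≤ Real.log t := by
    rw [Real.le_log_iff_exp_le ht0]
    exact le_trans (le_of_lt (lt_trans Real.exp_one_lt_d9 (by norm_num))) h2
  have hlog0 : 0 < Real.log t := by linarith
  -- the growth bound on `[0, t]`
  set Qb : ℝ := M + C * Real.log t ^ p with hQb
  have hQall : ∀ s ∈ Icc 0 t, P.bmGrowth (Φ s x) ≤ Qb := hMT t h1
  have hQb1 : 1 ≤ Qb := by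
    have := hQall 0 ⟨le_rfl, ht0.le⟩
    rw [h0 x hx] at this
    exact (P.lc_one_le_bmGrowth hU0 hV0 hx).trans this
  have hlogp1 : 1 ≤ Real.log t ^ p := Real.one_le_rpow hlog1 hp0.le
  have hQbM : Qb ≤ (M + C) * Real.log t ^ p := by
    rw [hQb]; nlinarith
  -- the distance
  set D₀ : ℝ := t * Real.log t ^ α with hD₀
  have hlogα0 : 0 < Real.log t ^ α := Real.rpow_pos_of_pos hlog0 α
  have hD₀0 : 0 < D₀ := by positivity
  set Dn : ℕ := (j - i).natAbs with hDn
  have hDnR : ((Dn : ℕ) : ℝ) = |(i : ℝ) - j| := by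
    rw [hDn, Nat.cast_natAbs]; push_cast; exact abs_sub_comm _ _
  have hD₀Dn : D₀ ≤ Dn := by rw [hDnR]; exact hj.le
  have hDn1 : 1 ≤ Dn := by
    have : (0 : ℝ) < Dn := hD₀0.trans_le hD₀Dn
    exact Nat.one_le_iff_ne_zero.2 (by rintro h; rw [h] at this; simp at this)
  -- the regime condition at `D₀`, then at `Dn`
  have hlogα : Real.log t ^ α ≤ t := by
    have := h3
    rw [one_mul, Real.norm_of_nonneg hlogα0.le, Real.rpow_one, Real.norm_of_nonneg ht0.le] at this
    exact this
  have hlogD₀ : 1 + Real.log (Real.exp 1 + 2 * D₀) ≤ 4 * Real.log t := by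
    have he3 : Real.exp 1 < 3 := lt_trans Real.exp_one_lt_d9 (by norm_num)
    have hb1 : Real.exp 1 + 2 * D₀ ≤ t ^ 3 := by
      rw [hD₀]
      have : t * Real.log t ^ α ≤ t * t := mul_le_mul_of_nonneg_left hlogα ht0.le
      nlinarith
    have hb2 : Real.log (Real.exp 1 + 2 * D₀) ≤ Real.log (t ^ 3) :=
      Real.log_le_log (by positivity) hb1
    rw [Real.log_pow] at hb2
    push_cast at hb2
    linarith
  set Kt : ℝ := 2 * Real.exp 1 * (3 * (Cp * Li * Qb)) * t with hKt
  have hKt0 : 0 ≤ Kt := by positivity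
  have hreg0 : Kt * (1 + Real.log (Real.exp 1 + 2 * D₀)) ≤ D₀ := by
    have hsplit : Real.log t ^ α = Real.log t ^ (α - p - 1) * Real.log t ^ (p + 1) := by
      rw [← Real.rpow_add hlog0]; ring_nf
    have hp1 : Real.log t ^ (p + 1) = Real.log t ^ p * Real.log t := by
      rw [Real.rpow_add hlog0, Real.rpow_one]
    calc Kt * (1 + Real.log (Real.exp 1 + 2 * D₀))
        ≤ (2 * Real.exp 1 * (3 * (Cp * Li * ((M + C) * Real.log t ^ p))) * t) *
            (4 * Real.log t) := by
          apply mul_le_mul _ hlogD₀ (by linarith [Real.log_nonneg (show (1:ℝ) ≤ Real.exp 1 + 2 * D₀ by linarith [Real.add_one_le_exp (1:ℝ)])]) (by positivity)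
          rw [hKt]; gcongr
      _ = K₀ * (t * (Real.log t ^ p * Real.log t)) := by rw [hK₀]; ring
      _ ≤ Real.log t ^ (α - p - 1) * (t * (Real.log t ^ p * Real.log t)) :=
          mul_le_mul_of_nonneg_right h4 (by positivity)
      _ = t * (Real.log t ^ (α - p - 1) * Real.log t ^ (p + 1)) := by rw [hp1]; ring
      _ = D₀ := by rw [hD₀, hsplit]
  have hKtD₀ : Kt ≤ D₀ := by
    refine le_trans ?_ hreg0
    have : 1 ≤ 1 + Real.log (Real.exp 1 + 2 * D₀) := by
      have := Real.log_nonneg (show (1:ℝ) ≤ Real.exp 1 + 2 * D₀ by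
        linarith [Real.add_one_le_exp (1:ℝ)])
      linarith
    exact le_mul_of_one_le_right hKt0 this
  have hregDn : Kt * (1 + Real.log (Real.exp 1 + 2 * (Dn : ℝ))) ≤ Dn :=
    lc_regime_mono hKt0 hKtD₀ hreg0 hD₀Dn
  have hreg : 2 * Real.exp 1 * (3 * (Cp * Real.log (Real.exp 1 + |(i : ℝ)|) * Qb) *
      (1 + Real.log (Real.exp 1 + (2 * (j - i).natAbs : ℕ))) * t) ≤ (j - i).natAbs := by
    have e : 2 * Real.exp 1 * (3 * (Cp * Real.log (Real.exp 1 + |(i : ℝ)|) * Qb) *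
        (1 + Real.log (Real.exp 1 + (2 * (j - i).natAbs : ℕ))) * t) =
        Kt * (1 + Real.log (Real.exp 1 + 2 * (Dn : ℝ))) := by
      rw [hKt, hLi, hDn]; push_cast; ring
    rw [e]; exact hregDn
  -- the perturbation estimate and the bracket
  obtain ⟨ε₁, hε₁, hz⟩ := hpert Φ hmaps h0 hsol hgrow x hx t ht0 Qb hQb1 hQall i j hDn1 hreg
  have hz' : ∀ z : ℝ × ℝ, ‖z - x i‖ ≤ ε₁ →
      ‖Φ t (Function.update x i z) j - Φ t x j‖ ≤ (2 * (1 / 2) ^ Dn) * ‖z - x i‖ := by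
    intro z hzz; have := hz z hzz; rw [hDn]; linarith
  have hbr := bracket_le (by positivity) hε₁ hz' hf hg hMf hMg
  -- the exponential factor
  have htail : (1 / 2 : ℝ) ^ Dn ≤ Real.exp (-(t * (b + 1))) := by
    refine lc_half_pow_le_exp ?_
    have hl2 : 0 < Real.log 2 := Real.log_pos one_lt_two
    have h5' : b + 1 ≤ Real.log t ^ α * Real.log 2 := by
      rwa [div_le_iff₀ hl2] at h5
    calc t * (b + 1) ≤ t * (Real.log t ^ α * Real.log 2) := mul_le_mul_of_nonneg_left h5' ht0.le
      _ = D₀ * Real.log 2 := by rw [hD₀]; ring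
      _ ≤ Dn * Real.log 2 := mul_le_mul_of_nonneg_right hD₀Dn hl2.le
  have hexp : Real.exp (b * t) * (1 / 2 : ℝ) ^ Dn ≤ Real.exp (-t) := by
    calc Real.exp (b * t) * (1 / 2 : ℝ) ^ Dn ≤ Real.exp (b * t) * Real.exp (-(t * (b + 1))) :=
          mul_le_mul_of_nonneg_left htail (Real.exp_pos _).le
      _ = Real.exp (-t) := by rw [← Real.exp_add]; ring_nf
  have hden : 0 < 4 * Mf * Mg + 1 := by positivity
  calc Real.exp (b * t) * |sitePoissonBracket i (siteObs f i) (siteObs g j ∘ Φ t) x|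
      ≤ Real.exp (b * t) * (2 * Mf * Mg * (2 * (1 / 2) ^ Dn)) :=
        mul_le_mul_of_nonneg_left hbr (Real.exp_pos _).le
    _ = 4 * Mf * Mg * (Real.exp (b * t) * (1 / 2) ^ Dn) := by ring
    _ ≤ 4 * Mf * Mg * Real.exp (-t) := mul_le_mul_of_nonneg_left hexp (by positivity)
    _ ≤ (4 * Mf * Mg + 1) * (ε / (4 * Mf * Mg + 1)) :=
        mul_le_mul (by linarith) h6.le (Real.exp_pos _).le hden.le
    _ = ε := by field_simp

/-! ### Section I: Borel–Cantelli for the growth of `Q` along integer times -/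

/-- The event `{Q > N}` (junk-free form) is measurable. [folklore] -/
theorem measurableSet_bmGrowthSet_gt (hUm : Measurable P.U) (hVm : Measurable P.V) (N : ℝ) :
    MeasurableSet {σ : ChainConfig | ∃ r ∈ P.bmGrowthSet σ, N < r} := by
  have : {σ : ChainConfig | ∃ r ∈ P.bmGrowthSet σ, N < r} =
      ⋃ μ : ℤ, ⋃ k : ℕ, {σ | Real.log (Real.exp 1 + |(μ : ℝ)|) < k ∧
        N < P.bmLocalEnergy μ k σ / (2 * (k : ℝ) + 1)} := by
    ext σ
    simp only [Set.mem_setOf_eq, Set.mem_iUnion, bmGrowthSet]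
    constructor
    · rintro ⟨r, ⟨μ, k, hk, rfl⟩, hr⟩; exact ⟨μ, k, hk, hr⟩
    · rintro ⟨μ, k, hk, hr⟩; exact ⟨_, ⟨μ, k, hk, rfl⟩, hr⟩
  rw [this]
  refine MeasurableSet.iUnion fun μ => MeasurableSet.iUnion fun k => ?_
  exact (MeasurableSet.const _).inter
    (measurableSet_lt measurable_const ((P.measurable_bmLocalEnergy hUm hVm μ k).div_const _))

/-- **Borel–Cantelli for `Q ∘ Φ_k`** (BM §4: `ω(ℬ) = 1`): under (2.3) and invariance of `ω`
under each `Φ_k`, for `δ > 1`, `ω`-a.s. `Q(Φ_k x) ≤ log^δ k` for all large `k`.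
[cite: ButtaMarchioro2016, §4 (definition of ℬ)] -/
theorem ae_eventually_growth_le (hUm : Measurable P.U) (hVm : Measurable P.V)
    {ω : Measure ChainConfig} (hω : P.HasSuperstabilityEstimate ω)
    {Φ : ℝ → ChainConfig → ChainConfig} (hmp : ∀ t : ℝ, MeasurePreserving (Φ t) ω ω)
    {δ : ℝ} (hδ : 1 < δ) :
    ∀ᵐ x ∂ω, ∀ᶠ k : ℕ in atTop, ∀ r ∈ P.bmGrowthSet (Φ k x), r ≤ Real.log k ^ δ := by
  obtain ⟨hprob, C, lam₀, hC, hlam₀, hss⟩ := hω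
  obtain ⟨K, hK, hbound⟩ := P.measure_bmGrowthSet_gt_le hUm hVm hlam₀ (hss lam₀ hlam₀ le_rfl)
  -- the events
  set E : ℝ → Set ChainConfig := fun N => {σ | ∃ r ∈ P.bmGrowthSet σ, N < r} with hE
  set B : ℕ → Set ChainConfig := fun k => (Φ k) ⁻¹' E (Real.log k ^ δ) with hB
  have hEB : ∀ k : ℕ, ω (B k) = ω (E (Real.log k ^ δ)) := fun k =>
    (hmp k).measure_preimage (P.measurableSet_bmGrowthSet_gt hUm hVm _).nullMeasurableSet
  -- eventually `λ₀ log^δ k - C ≥ max (3/2) (2 log k)`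
  have hlogT : Tendsto (fun k : ℕ => Real.log k) atTop atTop :=
    Real.tendsto_log_atTop.comp tendsto_natCast_atTop_atTop
  have hev1 : ∀ᶠ k : ℕ in atTop, max 1 (C + 3 / 2) ≤ Real.log k := hlogT.eventually_ge_atTop _
  have hev2 : ∀ᶠ k : ℕ in atTop, 3 / lam₀ ≤ Real.log k ^ (δ - 1) :=
    ((tendsto_rpow_atTop (by linarith)).comp hlogT).eventually_ge_atTop _
  obtain ⟨K₀, hK₀⟩ := eventually_atTop.1 (hev1.and hev2)
  have hgood : ∀ k : ℕ, K₀ ≤ k → 3 / 2 ≤ lam₀ * Real.log k ^ δ - C ∧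
      Real.exp (-(lam₀ * Real.log k ^ δ - C)) ≤ 1 / (k : ℝ) ^ 2 := by
    intro k hk
    obtain ⟨h1, h2⟩ := hK₀ k hk
    have hl1 : 1 ≤ Real.log k := le_trans (le_max_left _ _) h1
    have hl0 : 0 < Real.log k := by linarith
    have hkpos : (0 : ℝ) < k := by
      rcases Nat.eq_zero_or_pos k with hk0 | hk0
      · subst hk0; norm_num at hl1
      · exact_mod_cast hk0
    have hsplit : Real.log k ^ δ = Real.log k ^ (δ - 1) * Real.log k := by
      conv_lhs => rw [show δ = (δ - 1) + 1 by ring]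
      rw [Real.rpow_add hl0, Real.rpow_one]
    have hmain : 3 * Real.log k ≤ lam₀ * Real.log k ^ δ := by
      rw [hsplit]
      have : 3 ≤ lam₀ * Real.log k ^ (δ - 1) := by rwa [div_le_iff₀' hlam₀] at h2
      nlinarith
    have hC32 : C + 3 / 2 ≤ Real.log k := le_trans (le_max_right _ _) h1
    refine ⟨by linarith, ?_⟩
    have hk2 : 1 / (k : ℝ) ^ 2 = Real.exp (-(2 * Real.log k)) := by
      rw [Real.exp_neg, show (2 : ℝ) * Real.log k = ((2 : ℕ) : ℝ) * Real.log k by norm_num,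
        Real.exp_nat_mul, Real.exp_log hkpos, one_div]
    rw [hk2]
    exact Real.exp_le_exp.2 (by linarith)
  -- summable majorant
  set d : ℕ → ℝ := fun k => (if k < K₀ then 1 else 0) + 1 / (k : ℝ) ^ 2 * K.toReal with hd
  have hd0 : ∀ k, 0 ≤ d k := fun k => by
    simp only [hd]; positivity
  have hds : Summable d := by
    refine Summable.add ?_ ((Real.summable_one_div_nat_pow.2 one_lt_two).mul_right _)
    refine summable_of_ne_finset_zero (s := Finset.range K₀) fun k hk => ?_
    rw [Finset.mem_range] at hk
    simp [hk]
  have hle : ∀ k, ω (B k) ≤ ENNReal.ofReal (d k) := by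
    intro k
    rw [hEB]
    rcases Nat.lt_or_ge k K₀ with hk | hk
    · calc ω (E (Real.log k ^ δ)) ≤ 1 := prob_le_one
        _ ≤ ENNReal.ofReal (d k) := by
            rw [← ENNReal.ofReal_one]
            refine ENNReal.ofReal_le_ofReal ?_
            simp only [hd, if_pos hk]
            have : 0 ≤ 1 / (k : ℝ) ^ 2 * K.toReal := by positivity
            linarith
    · obtain ⟨h1, h2⟩ := hgood k hk
      calc ω (E (Real.log k ^ δ)) ≤ ENNReal.ofReal (Real.exp (-(lam₀ * Real.log k ^ δ - C))) * K :=
            hbound _ h1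
        _ ≤ ENNReal.ofReal (1 / (k : ℝ) ^ 2) * K := by gcongr
        _ = ENNReal.ofReal (1 / (k : ℝ) ^ 2 * K.toReal) := by
            rw [ENNReal.ofReal_mul (by positivity), ENNReal.ofReal_toReal hK]
        _ = ENNReal.ofReal (d k) := by simp only [hd, if_neg (not_lt.2 hk), zero_add]
  have hsum : ∑' k, ω (B k) ≠ ∞ := by
    have h1 : ∑' k, ω (B k) ≤ ∑' k, ENNReal.ofReal (d k) := ENNReal.tsum_le_tsum hle
    rw [← ENNReal.ofReal_tsum_of_nonneg hd0 hds] at h1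
    exact ne_top_of_le_ne_top ENNReal.ofReal_ne_top h1
  filter_upwards [ae_eventually_notMem hsum] with x hx
  refine hx.mono fun k hk r hr => ?_
  by_contra h
  exact hk ⟨r, hr, not_le.1 h⟩

/-! ### Section J: the theorem -/

/-- `0 ≤ η < 1` for `η = (σ-1)/σ`, `σ = max s₁ s₂ ≥ 1`. [cite: ButtaMarchioro2016, §2 Thm 2.1] -/
private theorem lc_eta_bounds {s₁ s₂ : ℕ} (hs₁ : 1 ≤ s₁) :
    0 ≤ (((max s₁ s₂ : ℕ) : ℝ) - 1) / ((max s₁ s₂ : ℕ) : ℝ) ∧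
      (((max s₁ s₂ : ℕ) : ℝ) - 1) / ((max s₁ s₂ : ℕ) : ℝ) < 1 := by
  have h1 : (1 : ℝ) ≤ ((max s₁ s₂ : ℕ) : ℝ) := by exact_mod_cast le_trans hs₁ (le_max_left _ _)
  have h0 : (0 : ℝ) < ((max s₁ s₂ : ℕ) : ℝ) := by linarith
  constructor
  · exact div_nonneg (by linarith) h0.le
  · rw [div_lt_one h0]; linarith

/-- **Buttà–Marchioro 2016, Theorem 2.2 for the chain (`d = ν = 1`) — proved.** The
almost-linear light cone `|i - j| > t log^α t`, `α > (4-η)/(2-η)`, for the Poisson brackets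
`{f_i, Φ_t g_j}` of single-site observables under the infinite-volume flow of Thm 2.1, almost
surely for every time-invariant state with the superstability estimate (2.3). The proof follows
§4 of the paper: Borel–Cantelli along integer times (`ae_eventually_growth_le`), growth control
on `[0,t]` from (2.7) (`growth_control`), and the bound on the sensitivity of `Φ_t(x)_j` to `x_i`
by the Lipschitz iteration over lattice paths (`perturbation_bound`, replacing the formal Jacobian
series (4.3)–(4.7) by difference quotients of the genuine flow, in the first-order form with
`|U''| ≤ C(1+U)`, which closes exactly under the printed hypothesis `α > (4-η)/(2-η)`).
[cite: ButtaMarchioro2016, §2 Thm 2.2 and §4] -/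
theorem ButtaMarchioro2016_thm22_chain_holds : ButtaMarchioro2016_thm22_chain := by
  intro P s₁ s₂ hs₁ _hs₂ hU hV Φ hmaps h0 hgrp hsol _huniq hbd ω hω hω0 hmp f g hf hg hMf hMg
    i α hα b _hb
  obtain ⟨Mf, hMf⟩ := hMf
  obtain ⟨Mg, hMg⟩ := hMg
  have hU0 := hU.nonneg
  have hV0 := hV.nonneg
  -- parameters
  obtain ⟨hη0, hη1⟩ := lc_eta_bounds (s₂ := s₂) hs₁
  obtain ⟨γ, δ, hγ1, hγ2, hδ1, hpar⟩ := exists_gamma_delta hη0 hη1 hα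
  have h2γ : 0 < 2 - γ := by linarith
  have hγ0 : 0 ≤ γ := hη0.trans hγ1.le
  obtain ⟨C, hC, hC'⟩ := hbd γ hγ1 hγ2 1 one_pos
  have ha : (0 : ℝ) ≤ 2 / (2 - γ) := by positivity
  have hc : (0 : ℝ) ≤ γ / (2 - γ) := by positivity
  have hgrow := P.grow_of_bd hU0 hV0 h0 ha zero_le_one hc hC'
  have hshort := P.short_of_bd hU0 hV0 ha zero_le_one hc hC'
  -- the almost sure set
  have hae := P.ae_eventually_growth_le hU.continuous.measurable hV.continuous.measurable hω hmp hδ1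
  have hgoodae : ∀ᵐ x ∂ω, x ∈ P.bmGood := mem_ae_iff.2 hω0
  filter_upwards [hae, hgoodae] with x hx hxg
  have hBC : ∀ᶠ k : ℕ in atTop, P.bmGrowth (Φ k x) ≤ Real.log k ^ δ :=
    hx.mono fun k hk => P.lc_bmGrowth_le hk
  have hC3 : 0 ≤ 3 * |C| := by positivity
  exact P.lightCone_at hU hV hs₁ hmaps h0 hgrp hsol hC3 hc hshort hgrow hxg
    (zero_lt_one.trans hδ1) hBC hpar hf hg hMf hMg i b

end OscillatorChain

end Literature.MathematicalPhysics.KineticTheory.HeatConduction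

end
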